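import Literature.NumberTheory.EllipticCurves.ModularSymbolsLattice
import Literature.NumberTheory.EllipticCurves.HeckeOperatorsGamma0Proofs
import HarnessLib

/-!
# Eichler–Shimura periods in weight `k ≥ 2`: a finitely generated, Hecke-stable, separating
# lattice of period functionals on `S_k(Γ₀(N))`

This file supplies, for every level `N` and every weight `k = n + 2 ≥ 2`, the "integral structure"
input of Shimura 1971, Thm. 3.48 — there stated as (3.5.20), *"there is a discrete `ℤ`-submodule
of `S_k(Γ')` of maximal rank stable under the Hecke operators"*, and proved in §8.4 from the
Eichler–Shimura isomorphism `S_{n+2}(Γ) ≅ H¹_P(Γ, X_n)` (Thm. 8.4), its Hecke equivariance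
(§8.3, (8.3.2), Prop. 8.5) and the lattice `H¹_P(Γ, ℤ^{n+1}) ⊆ H¹_P(Γ, ℝ^{n+1})` (Prop. 8.6) — in
the dual form that the algebraicity of Hecke eigenvalues actually uses
(`Literature.NumberTheory.EllipticCurves.NewformsCoeffFieldProofs`,
`gamma0_exists_heckeStableDualLattice`): the subgroup `periodLatticeK n` of the dual space
`S_{n+2}(Γ₀(N))^∧` generated by the **period functionals**
`f ↦ c_f(γ)(u, v)`, `γ ∈ Γ₀(N)`, `(u, v) ∈ ℤ²`, is

* finitely generated (`periodLatticeK_fg`; Shimura Prop. 8.6, proof: a cocycle is determined by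
  its values on finitely many generators of `Γ`),
* stable under the transposes `T_p^∨` of the Hecke operators `T_p` of
  `Literature.NumberTheory.EllipticCurves.HeckeOperators` for all primes `p`
  (`dualMap_heckeT_mem_periodLatticeK`; Shimura §8.3, (8.3.2) and Prop. 8.5), and
* separating: a cusp form all of whose periods vanish is zero
  (`eq_zero_of_forall_mem_periodLatticeK`; the injectivity half of Shimura Thm. 8.4),

see `periodLatticeK_fg_heckeStable_separating`. Everything is proved; only the *injectivity*
half of Eichler–Shimura is needed (no dimension count, no surjectivity).

## The objects (homogeneous model of `Symⁿ`)

For a cusp function `φ` on `ℍ` (`IsCuspFunction` of `ModularSymbolsProofs`: `h`-periodic,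
holomorphic, `→ 0` at `i∞`; e.g. `f`, `f ∣ γ`, `f ∣ βᵢ`) we use, instead of Shimura's
vector differential `𝔡(f) = f(z) (z, 1)ⁿ dz` ((8.2.12)), the scalar kernel in homogeneous
coordinates `p = (u, v) ∈ ℂ²`:

* `powPrimitive j φ τ = ∫_τ^{i∞} φ(z) zʲ dz`, *defined* by the integration-by-parts recursion from
  `eichlerPrimitive φ τ = ∫_τ^{i∞} φ(z) dz` (itself a cusp function, `IsCuspFunction.primitive`),
  so that all analysis reduces to the weight-`2` vertical-ray integral of `ModularSymbolsProofs`
  (`hasDerivAt_verticalIntegral`); `d/dτ = -φ(τ) τʲ` (`hasDerivAt_powPrimitive`) and exponential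
  decay in vertical strips (`exists_norm_powPrimitive_le`);
* `eichlerKernel n φ τ p = ∑ⱼ C(n,j) (∫_τ^{i∞} φ zʲ) vʲ (-u)ⁿ⁻ʲ = ∫_τ^{i∞} φ(z) (zv - u)ⁿ dz`,
  on which
  a matrix `g` acts by the linear substitution `p ↦ g p` (no denominators: this is
  `(cX + d)ⁿ P(gX)` for `P(X) ↔ P(u/v) vⁿ`);
* the **transformation law** (`IsCuspFunction.eichlerKernel_slash_sub_eq`, the computation of
  Shimura (8.2.15)–(8.2.20) and (8.3.5)): for `g ∈ GL₂(ℝ)⁺` with `φ`, `φ ∣[n+2] g` cusp functions,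
  `∫_τ^{i∞} (φ|g)(z)(zv - u)ⁿ dz - ∫_{gτ}^{i∞} φ(z)(zv' - u')ⁿ dz`, `(u', v') = g(u, v)`, is
  independent of `τ` (its `τ`-derivative vanishes since `(gτ)v' - u' = det g (τ v - u)/(cτ + d)`);
  for `g` fixing `∞` it vanishes (`eichlerKernel_slash_eq_of_apply_one_zero`, both sides `→ 0`);
* the **period cocycle** `periodFn n f γ p` of `f ∈ S_{n+2}(Γ₀(N))`, `γ ∈ SL(2, ℤ)` (the value
  of that constant; for `γ ∈ Γ₀(N)` the parabolic cocycle `u(γ)` of Shimura (8.2.20)), with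
  `c(γδ)(p) = c(δ)(p) + c(γ)(δ p)` (`periodFn_mul`), and the functionals
  `periodFunctionalK n γ q : f ↦ c_f(γ)(q)`, `q ∈ ℤ²`, generating `periodLatticeK n`.

## The three properties

* **Finite generation** (`periodLatticeK_fg`): by the cocycle relation every `λ_{γ,q}` is an
  integral combination of the `λ_{s,q'}` for `s` in a finite generating set of `Γ₀(N)`
  (`Group.FG`, from `ModularSymbolsLattice`), and each `λ_{s,q'}` is an integral combination of
  the `2(n+1)` moment functionals `f ↦ C(n,j) ∫ (f|s) zʲ`, `f ↦ C(n,j) ∫_{sI} f zʲ`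
  (`periodFunctionalK_eq_sum`) — integrality is free in the homogeneous model (`q ↦ δ q` maps
  `ℤ² → ℤ²`).
* **Hecke stability** (`periodFn_heckeT`, `dualMap_heckeT_mem_periodLatticeK`): with
  `T_p f = ∑ᵢ f ∣ βᵢ` over the coset representatives `βᵢ ∈ Δ₀ᴺ(p)` of `HeckeOperatorsGamma0Proofs`
  (`coe_heckeT_gamma0`) and the right action `βᵢ γ = γ'ᵢ β_{σ(i)}` of `Γ₀(N)` on them
  (`existsUnique_mem_delta0_mul_heckeRep` there; `heckePerm`, `heckePermElt`, a bijection by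
  uniqueness), the period of a translation `βᵢ` vanishes and the cocycle relation gives
  `c_{T_p f}(γ)(q) = ∑ᵢ c_f(γ'ᵢ)(β_{σ(i)} q)` — Shimura's formula (8.3.2)
  `v(γ) = ∑ᵢ αᵢ^ι u(γᵢ)`.
* **Separation** (`eq_zero_of_forall_periodFn_eq_zero`): if all `c_f(γ)`, `γ ∈ Γ₀(N)`, vanish
  then the Eichler integral `F(τ) = ∫_τ^{i∞} f(z)(z - τ)ⁿ dz` satisfies `F ∣[-n] γ = F`
  (`eichlerIntegralK_slash_eq_self`), is holomorphic, and is bounded at every cusp: for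
  `g ∈ SL(2, ℤ)`, `F ∣[-n] g = G - P` with `G(τ) = ∫_τ^{i∞}(f|g)(z)(z - τ)ⁿ dz → 0` and `P` a
  polynomial, `F ∣ g` is `N`-periodic (`g Tᴺ g⁻¹ ∈ Γ₀(N)`), so `P(τ + N) - P(τ) → 0` along a
  vertical line, whence the polynomial `P` is periodic, hence constant
  (`isBoundedAtImInfty_eichlerIntegralK_slash`). Thus `F ∈ M_{-n}(Γ₀(N))` (`eichlerIntegralKForm`),
  which is constant by Mathlib's `ModularForm.isZero_of_neg_weight` /
  `ModularForm.eq_const_of_weight_zero`, and `f = 0` because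
  `d/dτ ∫_τ^{i∞} φ (z-τ)^{m+1} = -(m+1) ∫_τ^{i∞} φ (z-τ)^m` and `d/dτ ∫_τ^{i∞} φ = -φ`
  (`eq_zero_of_eichlerKernel_diag_const`). Vanishing at the integer points `ℤ²` suffices since
  `c_f(γ)` is a polynomial in `(u, v)` (`periodFn_eq_zero_of_forall_int`).

## References

* G. Shimura, *Introduction to the arithmetic theory of automorphic functions*, Iwanami Shoten /
  Princeton UP, 1971: (3.5.20) (p. 84); §8.1–8.2 ((8.2.12)–(8.2.20), Thm. 8.4, pp. 230–234);
  §8.3 ((8.3.2), (8.3.4)–(8.3.5), Prop. 8.5, pp. 236–238); §8.4 (Prop. 8.6, pp. 239–241).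
* F. Diamond, J. Shurman, *A first course in modular forms*, GTM 228, Springer 2005, §5.2
  (Prop. 5.2.1, the representatives `βⱼ`), §6.5 (p. 237: `T_p` acts on `H₁(X₁(N), ℤ)`).
-/

noncomputable section

open scoped MatrixGroups ModularForm Topology Manifold

open CongruenceSubgroup Complex MeasureTheory Set Filter Function
open UpperHalfPlane hiding I

namespace Literature.NumberTheory.EllipticCurves.ModularForms

/-- `∫_τ^{i∞} φ(z) dz = i ∫₀^∞ φ(τ + it) dt`. [folklore] -/
def eichlerPrimitive (φ : ℍ → ℂ) (τ : ℍ) : ℂ :=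
  I * ∫ t in Ioi (0 : ℝ), φ (ofComplex ((τ : ℂ) + t * I))

/-- `∫_τ^{i∞} φ = (i/2π) V_φ(τ)` in terms of the vertical-ray integral of `ModularSymbolsProofs`. [folklore] -/
theorem eichlerPrimitive_eq (φ : ℍ → ℂ) (τ : ℍ) :
    eichlerPrimitive φ τ = (I / (2 * Real.pi)) * verticalIntegral φ τ := by
  have hπ : (2 * (Real.pi : ℂ)) ≠ 0 := by
    have : (Real.pi : ℂ) ≠ 0 := by exact_mod_cast Real.pi_ne_zero
    exact mul_ne_zero two_ne_zero this
  simp only [eichlerPrimitive, verticalIntegral]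
  field_simp

namespace IsCuspFunction

variable {h : ℝ} {φ : ℍ → ℂ} (hφ : IsCuspFunction h φ)
include hφ

/-- `d/dz ∫_z^{i∞} φ = -φ(z)`. [folklore] -/
theorem hasDerivAt_eichlerPrimitive {z : ℂ} (hz : 0 < z.im) :
    HasDerivAt (fun w : ℂ ↦ eichlerPrimitive φ (ofComplex w)) (-φ (ofComplex z)) z := by
  have H := (hφ.hasDerivAt_verticalIntegral hz).const_mul (I / (2 * Real.pi))
  simp_rw [← eichlerPrimitive_eq] at H
  refine H.congr_deriv ?_
  have hπ : (Real.pi : ℂ) ≠ 0 := by exact_mod_cast Real.pi_ne_zero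
  field_simp
  rw [I_sq]
  ring

/-- `q`-expansion: `∫_τ^{i∞} φ = (i/2π) ∑ cₙ (h/n) qⁿ`. [folklore] -/
theorem hasSum_eichlerPrimitive (τ : ℍ) :
    HasSum (fun n : ℕ ↦ (I / (2 * Real.pi)) *
      ((qExpansion h φ).coeff n * (h / n) * Periodic.qParam h τ ^ n)) (eichlerPrimitive φ τ) := by
  rw [eichlerPrimitive_eq]
  exact (hφ.hasSum_verticalIntegral τ).mul_left _

/-- Exponential decay: `|∫_τ^{i∞} φ| ≤ C e^{-2π im τ / h}` for `im τ ≥ 1`. [folklore] -/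
theorem exists_norm_eichlerPrimitive_le :
    ∃ C : ℝ, 0 ≤ C ∧ ∀ τ : ℍ, 1 ≤ τ.im →
      ‖eichlerPrimitive φ τ‖ ≤ C * Real.exp (-(2 * Real.pi / h) * τ.im) := by
  have hh := hφ.pos
  set ρ : ℝ := Real.exp (-(2 * Real.pi / h)) with hρ
  have hρ0 : 0 < ρ := Real.exp_pos _
  have hρ1 : ρ < 1 := Real.exp_lt_one_iff.mpr (by
    have : 0 < 2 * Real.pi / h := by positivity
    linarith)
  -- `A = ∑ |cₙ| h ρⁿ⁻¹`-type constant
  have hS := hφ.summable_norm_coeff_mul_pow hρ0.le hρ1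
  set A : ℝ := ∑' n : ℕ, ‖(qExpansion h φ).coeff n‖ * ρ ^ n
  have hA0 : 0 ≤ A := tsum_nonneg fun n ↦ by positivity
  refine ⟨h / (2 * Real.pi) * (A / ρ), by positivity, fun τ hτ ↦ ?_⟩
  have hq : ‖Periodic.qParam h τ‖ = Real.exp (-(2 * Real.pi / h) * τ.im) := by
    rw [Periodic.norm_qParam, UpperHalfPlane.coe_im]
    congr 1
    ring
  -- `‖q‖ ≤ ρ`
  have hqρ : ‖Periodic.qParam h τ‖ ≤ ρ := by
    rw [hq, hρ]
    apply Real.exp_le_exp.mpr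
    have : 0 < 2 * Real.pi / h := by positivity
    nlinarith
  -- termwise bound: `‖(I/2π) cₙ (h/n) qⁿ‖ ≤ (h/2π) ‖cₙ‖ ρ^(n) / ρ * ‖q‖`
  have hterm : ∀ n : ℕ, ‖(I / (2 * Real.pi)) *
      ((qExpansion h φ).coeff n * (h / n) * Periodic.qParam h τ ^ n)‖ ≤
      h / (2 * Real.pi) * ((‖(qExpansion h φ).coeff n‖ * ρ ^ n) / ρ * ‖Periodic.qParam h τ‖) := by
    intro n
    rcases Nat.eq_zero_or_pos n with rfl | hn
    · simp [hφ.coeff_zero]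
    · have hI : ‖(I / (2 * Real.pi) : ℂ)‖ = 1 / (2 * Real.pi) := by
        rw [norm_div, Complex.norm_I]
        simp [Real.pi_pos.le]
      rw [norm_mul, hI, norm_mul, norm_mul, norm_pow]
      have hhn : ‖(h / n : ℂ)‖ ≤ h := by
        rw [show (h / n : ℂ) = ((h / n : ℝ) : ℂ) by push_cast; rfl, Complex.norm_real,
          Real.norm_eq_abs, abs_of_nonneg (by positivity)]
        exact div_le_self hh.le (by exact_mod_cast hn)
      -- `‖q‖^n ≤ ρ^(n-1) ‖q‖`
      have hqn : ‖Periodic.qParam h τ‖ ^ n ≤ ρ ^ n / ρ * ‖Periodic.qParam h τ‖ := by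
        obtain ⟨m, rfl⟩ := Nat.exists_eq_succ_of_ne_zero hn.ne'
        rw [pow_succ, pow_succ, mul_div_assoc, div_self hρ0.ne', mul_one]
        exact mul_le_mul_of_nonneg_right (pow_le_pow_left₀ (norm_nonneg _) hqρ m)
          (norm_nonneg _)
      calc 1 / (2 * Real.pi) * (‖(qExpansion h φ).coeff n‖ * ‖(h / n : ℂ)‖ *
            ‖Periodic.qParam h τ‖ ^ n)
          ≤ 1 / (2 * Real.pi) * (‖(qExpansion h φ).coeff n‖ * h *
            (ρ ^ n / ρ * ‖Periodic.qParam h τ‖)) := by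
            gcongr
        _ = h / (2 * Real.pi) * ((‖(qExpansion h φ).coeff n‖ * ρ ^ n) / ρ *
            ‖Periodic.qParam h τ‖) := by ring
  have hsum2 : Summable fun n : ℕ ↦ h / (2 * Real.pi) *
      ((‖(qExpansion h φ).coeff n‖ * ρ ^ n) / ρ * ‖Periodic.qParam h τ‖) :=
    ((hS.div_const ρ).mul_right _).mul_left _
  have H := (hφ.hasSum_eichlerPrimitive τ).norm_le_of_bounded hsum2.hasSum hterm
  refine H.trans (le_of_eq ?_)
  rw [tsum_mul_left, tsum_mul_right, tsum_div_const, hq]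
  ring

/-- `∫_τ^{i∞} φ → 0` as `im τ → ∞`. [folklore] -/
theorem isZeroAtImInfty_eichlerPrimitive : IsZeroAtImInfty (eichlerPrimitive φ) := by
  obtain ⟨C, hC0, hC⟩ := hφ.exists_norm_eichlerPrimitive_le
  have hh := hφ.pos
  rw [IsZeroAtImInfty, ZeroAtFilter]
  apply tendsto_zero_iff_norm_tendsto_zero.mpr
  have him : Tendsto UpperHalfPlane.im atImInfty atTop := tendsto_comap
  have hexp : Tendsto (fun τ : ℍ ↦ C * Real.exp (-(2 * Real.pi / h) * τ.im)) atImInfty (𝓝 0) := by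
    have h1 : Tendsto (fun y : ℝ ↦ Real.exp (-(2 * Real.pi / h) * y)) atTop (𝓝 0) := by
      apply Real.tendsto_exp_atBot.comp
      have ha : -(2 * Real.pi / h) < 0 := by
        have : 0 < 2 * Real.pi / h := by positivity
        linarith
      exact Filter.Tendsto.const_mul_atTop_of_neg ha tendsto_id
    simpa using (h1.comp him).const_mul C
  refine squeeze_zero' (Eventually.of_forall fun τ ↦ norm_nonneg _) ?_ hexp
  rw [Filter.Eventually, atImInfty_mem]
  exact ⟨1, fun τ hτ ↦ hC τ hτ⟩

/-- Periodicity of `∫_τ^{i∞} φ`. [folklore] -/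
theorem periodic_eichlerPrimitive : Periodic (eichlerPrimitive φ ∘ ofComplex) h := by
  intro w
  by_cases hw : 0 < w.im
  · have hw' : 0 < (w + h).im := by simpa using hw
    simp only [comp_apply, eichlerPrimitive, ofComplex_apply_of_im_pos hw,
      ofComplex_apply_of_im_pos hw', UpperHalfPlane.coe_mk]
    congr 1
    refine setIntegral_congr_fun measurableSet_Ioi fun t _ ↦ ?_
    have := hφ.periodic (w + t * I)
    simp only [comp_apply] at this
    rw [show (w + h : ℂ) + t * I = w + t * I + h by ring, this]
  · have hw' : (w + h).im ≤ 0 := by simpa using hw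
    simp only [comp_apply, ofComplex_apply_eq_of_im_nonpos hw' (not_lt.mp hw)]

/-- **`∫_τ^{i∞} φ` is again a cuspidal `q`-series function** of the same period. [folklore] -/
theorem primitive : IsCuspFunction h (eichlerPrimitive φ) where
  pos := hφ.pos
  periodic := hφ.periodic_eichlerPrimitive
  mdifferentiable := UpperHalfPlane.mdifferentiable_iff.mpr fun _ hz ↦
    (hφ.hasDerivAt_eichlerPrimitive hz).differentiableAt.differentiableWithinAt
  isZeroAtImInfty := hφ.isZeroAtImInfty_eichlerPrimitive

omit hφ in
/-- Cusp functions are stable under addition. [folklore] -/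
theorem add {ψ : ℍ → ℂ} (hφ : IsCuspFunction h φ) (hψ : IsCuspFunction h ψ) :
    IsCuspFunction h (φ + ψ) where
  pos := hφ.pos
  periodic := by
    intro w
    have h1 := hφ.periodic w
    have h2 := hψ.periodic w
    simp only [comp_apply, Pi.add_apply] at h1 h2 ⊢
    rw [h1, h2]
  mdifferentiable := hφ.mdifferentiable.add hψ.mdifferentiable
  isZeroAtImInfty := hφ.isZeroAtImInfty.add hψ.isZeroAtImInfty

/-- Cusp functions are stable under scalar multiplication. [folklore] -/
theorem const_smul (c : ℂ) : IsCuspFunction h (c • φ) where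
  pos := hφ.pos
  periodic := by
    intro w
    have h1 := hφ.periodic w
    simp only [comp_apply, Pi.smul_apply] at h1 ⊢
    rw [h1]
  mdifferentiable := hφ.mdifferentiable.const_smul c
  isZeroAtImInfty := by
    have := hφ.isZeroAtImInfty.const_mul c
    simpa [IsZeroAtImInfty, ZeroAtFilter, Pi.smul_def] using this

omit hφ in
/-- Additivity of `∫_τ^{i∞}` (both rays integrable). [folklore] -/
theorem eichlerPrimitive_add {ψ : ℍ → ℂ} (hφ : IsCuspFunction h φ) (hψ : IsCuspFunction h ψ)
    (τ : ℍ) : eichlerPrimitive (φ + ψ) τ = eichlerPrimitive φ τ + eichlerPrimitive ψ τ := by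
  simp only [eichlerPrimitive, Pi.add_apply]
  rw [integral_add (hφ.integrableOn_ray τ) (hψ.integrableOn_ray τ), mul_add]

end IsCuspFunction

/-- Homogeneity of `∫_τ^{i∞}`. [folklore] -/
theorem eichlerPrimitive_const_smul (c : ℂ) (φ : ℍ → ℂ) (τ : ℍ) :
    eichlerPrimitive (c • φ) τ = c * eichlerPrimitive φ τ := by
  simp only [eichlerPrimitive, Pi.smul_apply, smul_eq_mul]
  rw [integral_const_mul]
  ring

/-- **Iterated Eichler integrals against powers**: `powPrimitive j φ τ = ∫_τ^{i∞} φ(z) zʲ dz`,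
*defined* by the integration-by-parts recursion
`∫_τ^{i∞} φ(z) z^{j+1} dz = τ^{j+1} ∫_τ^{i∞} φ + (j+1) ∫_τ^{i∞} (∫_z^{i∞} φ) z^j dz`. [folklore] -/
def powPrimitive : ℕ → (ℍ → ℂ) → ℍ → ℂ
  | 0, φ, τ => eichlerPrimitive φ τ
  | j + 1, φ, τ => (τ : ℂ) ^ (j + 1) * eichlerPrimitive φ τ +
      (j + 1) * powPrimitive j (eichlerPrimitive φ) τ

/-- Unfolding the recursion at `j = 0`. [folklore] -/
@[simp] theorem powPrimitive_zero (φ : ℍ → ℂ) (τ : ℍ) :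
    powPrimitive 0 φ τ = eichlerPrimitive φ τ := rfl

/-- Unfolding the recursion at `j + 1` (integration by parts). [folklore] -/
theorem powPrimitive_succ (j : ℕ) (φ : ℍ → ℂ) (τ : ℍ) :
    powPrimitive (j + 1) φ τ = (τ : ℂ) ^ (j + 1) * eichlerPrimitive φ τ +
      (j + 1) * powPrimitive j (eichlerPrimitive φ) τ := rfl

/-- **`d/dτ ∫_τ^{i∞} φ(z) zʲ dz = -φ(τ) τʲ`.** [folklore] -/
theorem IsCuspFunction.hasDerivAt_powPrimitive {h : ℝ} (j : ℕ) :
    ∀ {φ : ℍ → ℂ}, IsCuspFunction h φ → ∀ {z : ℂ}, 0 < z.im →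
      HasDerivAt (fun w : ℂ ↦ powPrimitive j φ (ofComplex w)) (-(φ (ofComplex z) * z ^ j)) z := by
  induction j with
  | zero =>
    intro φ hφ z hz
    simpa using hφ.hasDerivAt_eichlerPrimitive hz
  | succ j ih =>
    intro φ hφ z hz
    have h1 := hφ.hasDerivAt_eichlerPrimitive hz
    have h2 := ih hφ.primitive hz
    have h3 : HasDerivAt (fun w : ℂ ↦ w ^ (j + 1)) ((j + 1 : ℕ) * z ^ j) z := by
      simpa using hasDerivAt_pow (j + 1) z
    have H := (h3.mul h1).add (h2.const_mul ((j : ℂ) + 1))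
    have H' : HasDerivAt (fun w : ℂ ↦ w ^ (j + 1) * eichlerPrimitive φ (ofComplex w) +
        ((j : ℂ) + 1) * powPrimitive j (eichlerPrimitive φ) (ofComplex w))
        (-(φ (ofComplex z) * z ^ (j + 1))) z := by
      refine H.congr_deriv ?_
      push_cast
      ring
    refine H'.congr_of_eventuallyEq ?_
    filter_upwards [isOpen_upperHalfPlaneSet.mem_nhds hz] with w (hw : 0 < w.im)
    simp only [powPrimitive_succ, ofComplex_apply_of_im_pos hw]

/-- Homogeneity of the iterated integrals. [folklore] -/
theorem powPrimitive_const_smul (j : ℕ) (c : ℂ) : ∀ (φ : ℍ → ℂ) (τ : ℍ),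
    powPrimitive j (c • φ) τ = c * powPrimitive j φ τ := by
  induction j with
  | zero => intro φ τ; simp [eichlerPrimitive_const_smul]
  | succ j ih =>
    intro φ τ
    have hfun : eichlerPrimitive (c • φ) = c • eichlerPrimitive φ := by
      funext σ; simp [eichlerPrimitive_const_smul]
    rw [powPrimitive_succ, powPrimitive_succ, hfun, ih, Pi.smul_apply, smul_eq_mul]
    ring

/-- Additivity of the iterated integrals on cusp functions (of possibly different periods). [folklore] -/
theorem IsCuspFunction.powPrimitive_add (j : ℕ) :
    ∀ {h₁ h₂ : ℝ} {φ ψ : ℍ → ℂ}, IsCuspFunction h₁ φ → IsCuspFunction h₂ ψ → ∀ τ : ℍ,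
      powPrimitive j (φ + ψ) τ = powPrimitive j φ τ + powPrimitive j ψ τ := by
  induction j with
  | zero =>
    intro h₁ h₂ φ ψ hφ hψ τ
    simp only [powPrimitive_zero, eichlerPrimitive, Pi.add_apply]
    rw [integral_add (hφ.integrableOn_ray τ) (hψ.integrableOn_ray τ), mul_add]
  | succ j ih =>
    intro h₁ h₂ φ ψ hφ hψ τ
    have hfun : eichlerPrimitive (φ + ψ) = eichlerPrimitive φ + eichlerPrimitive ψ := by
      funext σ
      simp only [eichlerPrimitive, Pi.add_apply]
      rw [integral_add (hφ.integrableOn_ray σ) (hψ.integrableOn_ray σ), mul_add]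
    rw [powPrimitive_succ, powPrimitive_succ, powPrimitive_succ, hfun,
      ih hφ.primitive hψ.primitive, Pi.add_apply]
    ring

/-- Additivity of the iterated integrals over finite families of cusp functions. [folklore] -/
theorem powPrimitive_finset_sum {ι : Type*} (s : Finset ι) (j : ℕ) :
    ∀ {h : ι → ℝ} {φ : ι → ℍ → ℂ}, (∀ i ∈ s, IsCuspFunction (h i) (φ i)) → ∀ τ : ℍ,
      powPrimitive j (∑ i ∈ s, φ i) τ = ∑ i ∈ s, powPrimitive j (φ i) τ := by
  induction j with
  | zero =>
    intro h φ hφ τ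
    simp only [powPrimitive_zero, eichlerPrimitive, Finset.sum_apply]
    rw [integral_finsetSum s fun i hi ↦ (hφ i hi).integrableOn_ray τ, Finset.mul_sum]
  | succ j ih =>
    intro h φ hφ τ
    have hfun : eichlerPrimitive (∑ i ∈ s, φ i) = ∑ i ∈ s, eichlerPrimitive (φ i) := by
      funext σ
      simp only [eichlerPrimitive, Finset.sum_apply]
      rw [integral_finsetSum s fun i hi ↦ (hφ i hi).integrableOn_ray σ, Finset.mul_sum]
    rw [powPrimitive_succ, hfun, ih (fun i hi ↦ (hφ i hi).primitive), Finset.sum_apply,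
      Finset.mul_sum, Finset.mul_sum, ← Finset.sum_add_distrib]
    refine Finset.sum_congr rfl fun i _ ↦ ?_
    rw [powPrimitive_succ]

/-- **Exponential decay of the iterated integrals**:
`|∫_τ^{i∞} φ(z) zʲ dz| ≤ C (1 + |re τ| + im τ)ʲ e^{-2π im τ / h}` for `im τ ≥ 1`. [folklore] -/
theorem IsCuspFunction.exists_norm_powPrimitive_le {h : ℝ} (j : ℕ) :
    ∀ {φ : ℍ → ℂ}, IsCuspFunction h φ → ∃ C : ℝ, 0 ≤ C ∧ ∀ τ : ℍ, 1 ≤ τ.im →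
      ‖powPrimitive j φ τ‖ ≤
        C * (1 + |τ.re| + τ.im) ^ j * Real.exp (-(2 * Real.pi / h) * τ.im) := by
  induction j with
  | zero =>
    intro φ hφ
    obtain ⟨C, hC0, hC⟩ := hφ.exists_norm_eichlerPrimitive_le
    exact ⟨C, hC0, fun τ hτ ↦ by simpa using hC τ hτ⟩
  | succ j ih =>
    intro φ hφ
    obtain ⟨C₀, hC₀, h₀⟩ := hφ.exists_norm_eichlerPrimitive_le
    obtain ⟨C₁, hC₁, h₁⟩ := ih hφ.primitive
    refine ⟨C₀ + (j + 1) * C₁, by positivity, fun τ hτ ↦ ?_⟩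
    set B : ℝ := 1 + |τ.re| + τ.im with hB
    set e : ℝ := Real.exp (-(2 * Real.pi / h) * τ.im)
    have hB1 : 1 ≤ B := by
      have := abs_nonneg τ.re
      have := τ.im_pos
      linarith
    have hτB : ‖(τ : ℂ)‖ ≤ B := by
      have h1 := Complex.norm_le_abs_re_add_abs_im (τ : ℂ)
      rw [UpperHalfPlane.coe_re, UpperHalfPlane.coe_im, abs_of_pos τ.im_pos] at h1
      linarith
    have he : 0 ≤ e := (Real.exp_pos _).le
    rw [powPrimitive_succ]
    calc ‖(τ : ℂ) ^ (j + 1) * eichlerPrimitive φ τ +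
          (j + 1) * powPrimitive j (eichlerPrimitive φ) τ‖
        ≤ ‖(τ : ℂ)‖ ^ (j + 1) * ‖eichlerPrimitive φ τ‖ +
          (j + 1) * ‖powPrimitive j (eichlerPrimitive φ) τ‖ := by
          refine (norm_add_le _ _).trans (add_le_add ?_ ?_)
          · rw [norm_mul, norm_pow]
          · rw [norm_mul]
            gcongr
            exact le_of_eq (by norm_cast)
      _ ≤ B ^ (j + 1) * (C₀ * e) + (j + 1) * (C₁ * B ^ j * e) := by
          gcongr
          · exact h₀ τ hτ
          · exact h₁ τ hτ
      _ ≤ (C₀ + (j + 1) * C₁) * B ^ (j + 1) * e := by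
          have hBj : B ^ j ≤ B ^ (j + 1) := pow_le_pow_right₀ hB1 (Nat.le_succ j)
          have : (j + 1) * (C₁ * B ^ j * e) ≤ (j + 1) * (C₁ * B ^ (j + 1) * e) := by
            gcongr
          nlinarith [pow_nonneg (zero_le_one.trans hB1) (j + 1), this]

/-! ### Möbius transformations of `GL(2, ℝ)⁺` on `ℂ` -/

section MoebiusGL

variable (g : GL (Fin 2) ℝ)

/-- The complexified matrix of `g ∈ GL(2, ℝ)`. [folklore] -/
def cmat : Matrix (Fin 2) (Fin 2) ℂ := ((g : GL (Fin 2) ℝ) : Matrix (Fin 2) (Fin 2) ℝ).map (↑)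

/-- Entries of the complexified matrix. [folklore] -/
@[simp] theorem cmat_apply (i j : Fin 2) : cmat g i j = ((g i j : ℝ) : ℂ) := rfl

/-- On `ℍ`, `g • z = (az + b)/(cz + d)` for `det g > 0`. [folklore] -/
theorem coe_smul_ofComplex_of_det_pos {g : GL (Fin 2) ℝ} (hg : 0 < g.det.val) {z : ℂ}
    (hz : 0 < z.im) : ((g • ofComplex z : ℍ) : ℂ) = num g z / denom g z := by
  rw [coe_smul_of_det_pos hg, ofComplex_apply_of_im_pos hz]

/-- `g • z = (az + b)/(cz + d)` as points of `ℍ` (`det g > 0`). [folklore] -/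
theorem smul_ofComplex_of_det_pos {g : GL (Fin 2) ℝ} (hg : 0 < g.det.val) {z : ℂ}
    (hz : 0 < z.im) : g • ofComplex z = ofComplex (num g z / denom g z) := by
  rw [← ofComplex_apply (g • ofComplex z), coe_smul_ofComplex_of_det_pos hg hz]

/-- Möbius transformations of positive determinant preserve the upper half-plane. [folklore] -/
theorem moebius_im_pos_of_det_pos {g : GL (Fin 2) ℝ} (hg : 0 < g.det.val) {z : ℂ}
    (hz : 0 < z.im) : 0 < (num g z / denom g z).im := by
  rw [← coe_smul_ofComplex_of_det_pos hg hz]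
  exact (g • ofComplex z).im_pos

/-- `cz + d ≠ 0` for `im z > 0`. [folklore] -/
theorem denom_ofComplex_ne_zero {z : ℂ} (hz : 0 < z.im) : denom g z ≠ 0 :=
  denom_ne_zero_of_im g hz.ne'

/-- `d/dz (az + b)/(cz + d) = det g / (cz + d)²`. [folklore] -/
theorem hasDerivAt_moebiusGL {z : ℂ} (hz : 0 < z.im) :
    HasDerivAt (fun w : ℂ ↦ num g w / denom g w) ((g.det.val : ℂ) / (denom g z) ^ 2) z := by
  have hd := denom_ofComplex_ne_zero g hz
  have hnum : HasDerivAt (fun w : ℂ ↦ num g w) ((g 0 0 : ℝ) : ℂ) z := by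
    simpa [num] using ((hasDerivAt_id z).const_mul ((g 0 0 : ℝ) : ℂ)).add_const ((g 0 1 : ℝ) : ℂ)
  have hden : HasDerivAt (fun w : ℂ ↦ denom g w) ((g 1 0 : ℝ) : ℂ) z := by
    simpa [denom] using
      ((hasDerivAt_id z).const_mul ((g 1 0 : ℝ) : ℂ)).add_const ((g 1 1 : ℝ) : ℂ)
  refine (hnum.div hden hd).congr_deriv ?_
  rw [Matrix.GeneralLinearGroup.val_det_apply, Matrix.det_fin_two]
  simp only [num, denom]
  push_cast
  ring

end MoebiusGL

/-! ### The Eichler–Shimura kernel `∫_τ^{i∞} φ(z) (zv - u)ⁿ dz` -/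

section Kernel

variable (n : ℕ)

/-- **The Eichler–Shimura kernel** in homogeneous coordinates `p = (u, v)`:
`eichlerKernel n φ τ p = ∫_τ^{i∞} φ(z) (z v - u)ⁿ dz = ∑ⱼ C(n,j) (∫_τ^{i∞} φ zʲ) vʲ (-u)ⁿ⁻ʲ`. [cite: Shimura1971, §8.2 (8.2.12)] -/
def eichlerKernel (φ : ℍ → ℂ) (τ : ℍ) (p : Fin 2 → ℂ) : ℂ :=
  ∑ j ∈ Finset.range (n + 1),
    (n.choose j : ℂ) * powPrimitive j φ τ * p 1 ^ j * (-(p 0)) ^ (n - j)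

variable {n}

/-- Additivity of the kernel on cusp functions. [folklore] -/
theorem IsCuspFunction.eichlerKernel_add {h₁ h₂ : ℝ} {φ ψ : ℍ → ℂ} (hφ : IsCuspFunction h₁ φ)
    (hψ : IsCuspFunction h₂ ψ) (τ : ℍ) (p : Fin 2 → ℂ) :
    eichlerKernel n (φ + ψ) τ p = eichlerKernel n φ τ p + eichlerKernel n ψ τ p := by
  simp only [eichlerKernel, ← Finset.sum_add_distrib]
  refine Finset.sum_congr rfl fun j _ ↦ ?_
  rw [hφ.powPrimitive_add j hψ τ]
  ring

/-- Additivity of the kernel over finite families of cusp functions. [folklore] -/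
theorem eichlerKernel_finset_sum {ι : Type*} (s : Finset ι) {h : ι → ℝ} {φ : ι → ℍ → ℂ}
    (hφ : ∀ i ∈ s, IsCuspFunction (h i) (φ i)) (τ : ℍ) (p : Fin 2 → ℂ) :
    eichlerKernel n (∑ i ∈ s, φ i) τ p = ∑ i ∈ s, eichlerKernel n (φ i) τ p := by
  simp only [eichlerKernel, powPrimitive_finset_sum s _ hφ, Finset.sum_mul, Finset.mul_sum]
  rw [Finset.sum_comm]

/-- Homogeneity of the kernel. [folklore] -/
theorem eichlerKernel_const_smul (c : ℂ) (φ : ℍ → ℂ) (τ : ℍ) (p : Fin 2 → ℂ) :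
    eichlerKernel n (c • φ) τ p = c * eichlerKernel n φ τ p := by
  simp only [eichlerKernel, Finset.mul_sum]
  refine Finset.sum_congr rfl fun j _ ↦ ?_
  rw [powPrimitive_const_smul]
  ring

variable (n) in
/-- **`d/dτ ∫_τ^{i∞} φ(z)(zv - u)ⁿ dz = -φ(τ)(τ v - u)ⁿ`.** [folklore] -/
theorem IsCuspFunction.hasDerivAt_eichlerKernel {h : ℝ} {φ : ℍ → ℂ} (hφ : IsCuspFunction h φ)
    (p : Fin 2 → ℂ) {z : ℂ} (hz : 0 < z.im) :
    HasDerivAt (fun w : ℂ ↦ eichlerKernel n φ (ofComplex w) p)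
      (-(φ (ofComplex z) * (z * p 1 - p 0) ^ n)) z := by
  have H : HasDerivAt (fun w : ℂ ↦ eichlerKernel n φ (ofComplex w) p)
      (∑ j ∈ Finset.range (n + 1),
        (n.choose j : ℂ) * (-(φ (ofComplex z) * z ^ j)) * p 1 ^ j * (-(p 0)) ^ (n - j)) z := by
    simp only [eichlerKernel]
    apply HasDerivAt.fun_sum
    intro j _
    have := ((hφ.hasDerivAt_powPrimitive j hz).const_mul (n.choose j : ℂ)).mul_const
      (p 1 ^ j * (-(p 0)) ^ (n - j))
    simpa [mul_assoc] using this
  refine H.congr_deriv ?_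
  rw [sub_eq_add_neg, add_pow, Finset.mul_sum, ← Finset.sum_neg_distrib]
  refine Finset.sum_congr rfl fun j _ ↦ ?_
  ring

end Kernel

/-! ### The transformation law under `GL(2, ℝ)⁺` -/

section Transformation

variable {n : ℕ} {h₁ h₂ : ℝ} {φ : ℍ → ℂ} {g : GL (Fin 2) ℝ}

/-- The key algebraic identity: `(gz) v' - u' = det g (z v - u)/(cz + d)` where
`(u', v') = g (u, v)`. [folklore] -/
theorem moebius_mul_sub_eq (g : GL (Fin 2) ℝ) (p : Fin 2 → ℂ) {z : ℂ} (hz : denom g z ≠ 0) :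
    num g z / denom g z * (cmat g).mulVec p 1 - (cmat g).mulVec p 0 =
      (g.det.val : ℂ) * (z * p 1 - p 0) / denom g z := by
  have key : num g z / denom g z * (cmat g).mulVec p 1 - (cmat g).mulVec p 0 =
      (num g z * (cmat g).mulVec p 1 - (cmat g).mulVec p 0 * denom g z) / denom g z := by
    field_simp
  rw [key, div_left_inj' hz, Matrix.GeneralLinearGroup.val_det_apply, Matrix.det_fin_two]
  simp only [Matrix.mulVec, dotProduct, Fin.sum_univ_two, cmat_apply, num, denom]
  push_cast
  ring

/-- **Transformation law, differential form.** If `φ` and `ψ = φ ∣[n+2] g` (`det g > 0`) are cusp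
functions then `w ↦ ∫_w^{i∞} ψ(z)(zv - u)ⁿ dz - ∫_{gw}^{i∞} φ(z)(zv' - u')ⁿ dz`, `(u',v') = g(u,v)`,
has derivative `0`. [cite: Shimura1971, §8.2 (8.2.15)–(8.2.20) and §8.3 (8.3.5)] -/
theorem IsCuspFunction.hasDerivAt_eichlerKernel_slash_sub (hg : 0 < g.det.val)
    (hφ : IsCuspFunction h₁ φ) (hψ : IsCuspFunction h₂ (φ ∣[(n + 2 : ℤ)] g)) (p : Fin 2 → ℂ)
    {z : ℂ} (hz : 0 < z.im) :
    HasDerivAt (fun w : ℂ ↦ eichlerKernel n (φ ∣[(n + 2 : ℤ)] g) (ofComplex w) p -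
      eichlerKernel n φ (ofComplex (num g w / denom g w)) ((cmat g).mulVec p)) 0 z := by
  have hd := denom_ofComplex_ne_zero g hz
  have h1 := hψ.hasDerivAt_eichlerKernel n p hz
  have h2 := ((hφ.hasDerivAt_eichlerKernel n ((cmat g).mulVec p)
    (moebius_im_pos_of_det_pos hg hz)).comp z (hasDerivAt_moebiusGL g hz))
  refine (h1.sub h2).congr_deriv ?_
  rw [moebius_mul_sub_eq g p hd, ModularForm.slash_apply, σ_eq_self hg,
    smul_ofComplex_of_det_pos hg hz, abs_of_pos hg]
  have hden : denom g (ofComplex z) = denom g z := by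
    simp [denom, ofComplex_apply_of_im_pos hz]
  have e1 : ((n : ℤ) + 2 - 1) = ((n + 1 : ℕ) : ℤ) := by push_cast; ring
  have e2 : ((n : ℤ) + 2) = ((n + 2 : ℕ) : ℤ) := by push_cast; ring
  rw [hden, e1, zpow_natCast, e2, zpow_neg, zpow_natCast, div_pow, mul_pow]
  field_simp
  ring

/-- **Transformation law.** For cusp functions `φ` and `φ ∣[n+2] g` (`det g > 0`), the quantity
`∫_τ^{i∞} (φ|g)(z)(zv - u)ⁿ dz - ∫_{gτ}^{i∞} φ(z)(zv' - u')ⁿ dz`, `(u', v') = g(u, v)`, does not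
depend on `τ ∈ ℍ` (the *period polynomial* of `g`). [cite: Shimura1971, §8.2 (8.2.19)–(8.2.20) and §8.3 (8.3.5)] -/
theorem IsCuspFunction.eichlerKernel_slash_sub_eq (hg : 0 < g.det.val)
    (hφ : IsCuspFunction h₁ φ) (hψ : IsCuspFunction h₂ (φ ∣[(n + 2 : ℤ)] g)) (p : Fin 2 → ℂ)
    (τ τ' : ℍ) :
    eichlerKernel n (φ ∣[(n + 2 : ℤ)] g) τ p - eichlerKernel n φ (g • τ) ((cmat g).mulVec p) =
      eichlerKernel n (φ ∣[(n + 2 : ℤ)] g) τ' p -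
        eichlerKernel n φ (g • τ') ((cmat g).mulVec p) := by
  set D : ℂ → ℂ := fun w ↦ eichlerKernel n (φ ∣[(n + 2 : ℤ)] g) (ofComplex w) p -
      eichlerKernel n φ (ofComplex (num g w / denom g w)) ((cmat g).mulVec p)
  have hD : ∀ σ' : ℍ, D σ' = eichlerKernel n (φ ∣[(n + 2 : ℤ)] g) σ' p -
      eichlerKernel n φ (g • σ') ((cmat g).mulVec p) := by
    intro σ'
    simp only [D]
    rw [← smul_ofComplex_of_det_pos hg σ'.im_pos, ofComplex_apply]
  rw [← hD, ← hD]
  refine isOpen_upperHalfPlaneSet.is_const_of_deriv_eq_zero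
    (convex_halfSpace_im_gt 0).isPreconnected
    (fun w hw ↦ (hφ.hasDerivAt_eichlerKernel_slash_sub hg hψ p hw).differentiableAt
      |>.differentiableWithinAt)
    (fun w hw ↦ (hφ.hasDerivAt_eichlerKernel_slash_sub hg hψ p hw).deriv) τ.im_pos τ'.im_pos

end Transformation

/-! ### Decay of the kernel at `i∞` and vanishing of the period polynomial of a translation -/

section Decay

variable {n : ℕ} {h : ℝ} {φ : ℍ → ℂ}

/-- **Exponential decay of the kernel**:
`|∫_τ^{i∞} φ(z)(zv - u)ⁿ dz| ≤ C ((1 + |re τ| + im τ)|v| + |u|)ⁿ e^{-2π im τ/h}` for `im τ ≥ 1`. [folklore] -/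
theorem IsCuspFunction.exists_norm_eichlerKernel_le (hφ : IsCuspFunction h φ) :
    ∃ C : ℝ, 0 ≤ C ∧ ∀ (τ : ℍ) (p : Fin 2 → ℂ), 1 ≤ τ.im →
      ‖eichlerKernel n φ τ p‖ ≤
        C * ((1 + |τ.re| + τ.im) * ‖p 1‖ + ‖p 0‖) ^ n * Real.exp (-(2 * Real.pi / h) * τ.im) := by
  choose C hC0 hC using fun j ↦ IsCuspFunction.exists_norm_powPrimitive_le (h := h) j hφ
  set Cs : ℝ := ∑ j ∈ Finset.range (n + 1), C j with hCs
  have hCs0 : 0 ≤ Cs := Finset.sum_nonneg fun j _ ↦ hC0 j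
  have hCj : ∀ j ∈ Finset.range (n + 1), C j ≤ Cs := fun j hj ↦
    Finset.single_le_sum (fun i _ ↦ hC0 i) hj
  refine ⟨Cs, hCs0, fun τ p hτ ↦ ?_⟩
  set B : ℝ := 1 + |τ.re| + τ.im
  set e : ℝ := Real.exp (-(2 * Real.pi / h) * τ.im)
  have he : 0 ≤ e := (Real.exp_pos _).le
  have hB : 0 ≤ B := by
    have := abs_nonneg τ.re
    have := τ.im_pos
    simp only [B]; linarith
  calc ‖eichlerKernel n φ τ p‖
      ≤ ∑ j ∈ Finset.range (n + 1),
          ‖(n.choose j : ℂ) * powPrimitive j φ τ * p 1 ^ j * (-(p 0)) ^ (n - j)‖ :=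
        norm_sum_le _ _
    _ ≤ ∑ j ∈ Finset.range (n + 1),
          Cs * e * ((B * ‖p 1‖) ^ j * ‖p 0‖ ^ (n - j) * (n.choose j : ℝ)) := by
        refine Finset.sum_le_sum fun j hj ↦ ?_
        rw [norm_mul, norm_mul, norm_mul, norm_pow, norm_pow, norm_neg, Complex.norm_natCast]
        calc (n.choose j : ℝ) * ‖powPrimitive j φ τ‖ * ‖p 1‖ ^ j * ‖p 0‖ ^ (n - j)
            ≤ (n.choose j : ℝ) * (Cs * B ^ j * e) * ‖p 1‖ ^ j * ‖p 0‖ ^ (n - j) := by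
              gcongr
              exact (hC j τ hτ).trans (by gcongr; exact hCj j hj)
          _ = Cs * e * ((B * ‖p 1‖) ^ j * ‖p 0‖ ^ (n - j) * (n.choose j : ℝ)) := by ring
    _ = Cs * (B * ‖p 1‖ + ‖p 0‖) ^ n * e := by
        rw [← Finset.mul_sum, ← add_pow]
        ring

/-- `(A + B y)ⁿ e^{-a y} → 0` as `y → ∞` (`a > 0`). [folklore] -/
theorem tendsto_affine_pow_mul_exp_neg_atTop (A B : ℝ) (n : ℕ) {a : ℝ} (ha : 0 < a) :
    Tendsto (fun y : ℝ ↦ (A + B * y) ^ n * Real.exp (-a * y)) atTop (𝓝 0) := by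
  have hpoly : ∀ y : ℝ, (A + B * y) ^ n =
      ∑ j ∈ Finset.range (n + 1), (B ^ j * A ^ (n - j) * (n.choose j : ℝ)) * y ^ j := by
    intro y
    rw [add_comm, add_pow]
    refine Finset.sum_congr rfl fun j _ ↦ ?_
    rw [mul_pow]; ring
  simp_rw [hpoly, Finset.sum_mul]
  rw [show (0 : ℝ) = ∑ j ∈ Finset.range (n + 1), 0 by simp]
  refine tendsto_finsetSum _ fun j _ ↦ ?_
  have h2 : Tendsto (fun y : ℝ ↦ (a * y) ^ j * Real.exp (-(a * y))) atTop (𝓝 0) :=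
    (Real.tendsto_pow_mul_exp_neg_atTop_nhds_zero j).comp (tendsto_id.const_mul_atTop ha)
  have h3 := h2.const_mul ((B ^ j * A ^ (n - j) * (n.choose j : ℝ)) / a ^ j)
  rw [mul_zero] at h3
  refine h3.congr fun y ↦ ?_
  rw [mul_pow, neg_mul]
  field_simp

/-- Along a vertical line the kernel tends to `0`: for fixed `x`, `p`,
`∫_{x+iy}^{i∞} φ(z)(zv - u)ⁿ dz → 0` as `y → ∞`. [folklore] -/
theorem IsCuspFunction.tendsto_eichlerKernel_atTop (hφ : IsCuspFunction h φ) (x : ℝ)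
    (p : Fin 2 → ℂ) :
    Tendsto (fun y : ℝ ↦ eichlerKernel n φ (ofComplex (x + y * I)) p) atTop (𝓝 0) := by
  obtain ⟨C, hC0, hC⟩ := hφ.exists_norm_eichlerKernel_le (n := n)
  have hh := hφ.pos
  have ha : 0 < 2 * Real.pi / h := by positivity
  have hmaj : Tendsto (fun y : ℝ ↦ C * (((1 + |x| + y) * ‖p 1‖ + ‖p 0‖) ^ n *
      Real.exp (-(2 * Real.pi / h) * y))) atTop (𝓝 0) := by
    have h1 := tendsto_affine_pow_mul_exp_neg_atTop ((1 + |x|) * ‖p 1‖ + ‖p 0‖) ‖p 1‖ n ha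
    have h2 := h1.const_mul C
    rw [mul_zero] at h2
    refine h2.congr fun y ↦ ?_
    congr 3
    ring
  refine squeeze_zero_norm' ?_ hmaj
  filter_upwards [eventually_ge_atTop (1 : ℝ)] with y hy
  have hy0 : 0 < y := by linarith
  have him : 0 < (x + y * I : ℂ).im := by simpa using hy0
  have hτ : (ofComplex (x + y * I) : ℍ).im = y := by
    rw [← UpperHalfPlane.coe_im, ofComplex_apply_of_im_pos him]; simp
  have hτre : (ofComplex (x + y * I) : ℍ).re = x := by
    rw [← UpperHalfPlane.coe_re, ofComplex_apply_of_im_pos him]; simp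
  have := hC (ofComplex (x + y * I)) p (by rw [hτ]; exact hy)
  rw [hτ, hτre, mul_assoc] at this
  exact this

/-- Along a vertical line the *diagonal* kernel tends to `0`:
`∫_{x+iy}^{i∞} φ(z)(z - (x + iy))ⁿ dz → 0` as `y → ∞`. [folklore] -/
theorem IsCuspFunction.tendsto_eichlerKernel_diag_atTop (hφ : IsCuspFunction h φ) (x : ℝ) :
    Tendsto (fun y : ℝ ↦ eichlerKernel n φ (ofComplex (x + y * I)) ![x + y * I, 1])
      atTop (𝓝 0) := by
  obtain ⟨C, hC0, hC⟩ := hφ.exists_norm_eichlerKernel_le (n := n)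
  have hh := hφ.pos
  have ha : 0 < 2 * Real.pi / h := by positivity
  have hmaj : Tendsto (fun y : ℝ ↦ C * ((1 + 2 * |x| + 2 * y) ^ n *
      Real.exp (-(2 * Real.pi / h) * y))) atTop (𝓝 0) := by
    have h1 := tendsto_affine_pow_mul_exp_neg_atTop (1 + 2 * |x|) 2 n ha
    have h2 := h1.const_mul C
    rw [mul_zero] at h2
    exact h2
  refine squeeze_zero_norm' ?_ hmaj
  filter_upwards [eventually_ge_atTop (1 : ℝ)] with y hy
  have hy0 : 0 < y := by linarith
  have him : 0 < (x + y * I : ℂ).im := by simpa using hy0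
  have hτ : (ofComplex (x + y * I) : ℍ).im = y := by
    rw [← UpperHalfPlane.coe_im, ofComplex_apply_of_im_pos him]; simp
  have hτre : (ofComplex (x + y * I) : ℍ).re = x := by
    rw [← UpperHalfPlane.coe_re, ofComplex_apply_of_im_pos him]; simp
  have := hC (ofComplex (x + y * I)) ![x + y * I, 1] (by rw [hτ]; exact hy)
  rw [hτ, hτre] at this
  refine this.trans ?_
  rw [mul_assoc]
  refine mul_le_mul_of_nonneg_left (mul_le_mul_of_nonneg_right ?_ (Real.exp_pos _).le) hC0
  apply pow_le_pow_left₀ (by positivity)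
  have hn : ‖(x + y * I : ℂ)‖ ≤ |x| + y := by
    refine (Complex.norm_le_abs_re_add_abs_im _).trans (le_of_eq ?_)
    simp [abs_of_pos hy0]
  simp only [Matrix.cons_val_one, Matrix.cons_val_zero, norm_one, mul_one]
  linarith

variable {h₁ h₂ : ℝ} {g : GL (Fin 2) ℝ}

/-- **The period polynomial of a matrix fixing `∞` vanishes**: if `g = (a b; 0 d)` with `det g > 0`
and `φ`, `φ ∣[n+2] g` are cusp functions, then
`∫_τ^{i∞} (φ|g)(z)(zv - u)ⁿ dz = ∫_{gτ}^{i∞} φ(z)(zv' - u')ⁿ dz`, `(u', v') = g(u, v)`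
(both sides are constant in `τ` apart and tend to `0` along `τ = iy`, `y → ∞`). [cite: Shimura1971, §8.3 proof of Prop. 8.5] -/
theorem IsCuspFunction.eichlerKernel_slash_eq_of_apply_one_zero (hg : 0 < g.det.val)
    (hg10 : g 1 0 = 0) (hφ : IsCuspFunction h₁ φ) (hψ : IsCuspFunction h₂ (φ ∣[(n + 2 : ℤ)] g))
    (p : Fin 2 → ℂ) (τ : ℍ) :
    eichlerKernel n (φ ∣[(n + 2 : ℤ)] g) τ p = eichlerKernel n φ (g • τ) ((cmat g).mulVec p) := by
  -- entries: `a = g 0 0`, `b = g 0 1`, `d = g 1 1`, `a d > 0`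
  have hdet : g.det.val = g 0 0 * g 1 1 := by
    rw [Matrix.GeneralLinearGroup.val_det_apply, Matrix.det_fin_two, hg10]; ring
  have hd0 : (g 1 1 : ℝ) ≠ 0 := fun h0 ↦ by rw [hdet, h0, mul_zero] at hg; exact lt_irrefl _ hg
  have had : 0 < g 0 0 / g 1 1 := by
    have : 0 < g 0 0 * g 1 1 := hdet ▸ hg
    rcases lt_or_gt_of_ne hd0 with h | h
    · exact div_pos_of_neg_of_neg (by nlinarith) h
    · exact div_pos (by nlinarith) h
  -- the difference `D` is constant in `τ`
  set D : ℂ := eichlerKernel n (φ ∣[(n + 2 : ℤ)] g) τ p -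
    eichlerKernel n φ (g • τ) ((cmat g).mulVec p)
  have hconst : ∀ y : ℝ, 0 < y →
      eichlerKernel n (φ ∣[(n + 2 : ℤ)] g) (ofComplex (((0 : ℝ) : ℂ) + y * I)) p -
      eichlerKernel n φ (g • ofComplex (((0 : ℝ) : ℂ) + y * I)) ((cmat g).mulVec p) = D :=
    fun y hy ↦ hφ.eichlerKernel_slash_sub_eq hg hψ p _ τ
  -- `g • iy = b/d + i (a/d) y`
  have hsmul : ∀ y : ℝ, 0 < y → g • ofComplex (((0 : ℝ) : ℂ) + y * I) =
      ofComplex ((g 0 1 / g 1 1 : ℝ) + ((g 0 0 / g 1 1) * y : ℝ) * I) := by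
    intro y hy
    have him : 0 < (((0 : ℝ) : ℂ) + y * I : ℂ).im := by simpa using hy
    have him' : 0 < (((g 0 1 / g 1 1 : ℝ) : ℂ) + (((g 0 0 / g 1 1) * y : ℝ) : ℂ) * I).im := by
      simpa using mul_pos had hy
    rw [smul_ofComplex_of_det_pos hg him]
    congr 1
    simp only [num, denom, hg10]
    push_cast
    field_simp
    ring
  -- both terms tend to `0` along `iy`
  have h1 := hψ.tendsto_eichlerKernel_atTop (n := n) 0 p
  have h2 : Tendsto (fun y : ℝ ↦ eichlerKernel n φ (g • ofComplex (((0 : ℝ) : ℂ) + y * I))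
      ((cmat g).mulVec p)) atTop (𝓝 0) := by
    have h3 := (hφ.tendsto_eichlerKernel_atTop (n := n) (g 0 1 / g 1 1) ((cmat g).mulVec p)).comp
      (tendsto_id.const_mul_atTop had)
    refine h3.congr' ?_
    filter_upwards [eventually_gt_atTop (0 : ℝ)] with y hy
    simp only [comp_apply, id_eq]
    rw [hsmul y hy]
  have hD : Tendsto (fun _ : ℝ ↦ D) atTop (𝓝 (0 - 0)) := by
    refine (h1.sub h2).congr' ?_
    filter_upwards [eventually_gt_atTop (0 : ℝ)] with y hy
    exact hconst y hy
  rw [sub_zero] at hD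
  have hD0 : D = 0 := tendsto_nhds_unique tendsto_const_nhds hD
  exact sub_eq_zero.mp hD0

end Decay

/-! ### Period cocycles of cusp forms on `Γ₀(N)` -/

section Cocycle

variable {N : ℕ} [NeZero N] {n : ℕ}

/-- The complexified matrix of `γ ∈ SL(2, ℤ)`. [folklore] -/
def icmat (γ : SL(2, ℤ)) : Matrix (Fin 2) (Fin 2) ℂ := (γ : Matrix (Fin 2) (Fin 2) ℤ).map (↑)

/-- Entries of the complexified matrix. [folklore] -/
@[simp] theorem icmat_apply (γ : SL(2, ℤ)) (i j : Fin 2) : icmat γ i j = ((γ i j : ℤ) : ℂ) := rfl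

/-- Complexification is multiplicative. [folklore] -/
theorem icmat_mul (γ δ : SL(2, ℤ)) : icmat (γ * δ) = icmat γ * icmat δ := by
  simp only [icmat, Matrix.SpecialLinearGroup.coe_mul]
  exact Matrix.map_mul (f := Int.castRingHom ℂ)

/-- Complexification of `1`. [folklore] -/
@[simp] theorem icmat_one : icmat 1 = 1 := by
  ext i j
  fin_cases i <;> fin_cases j <;> simp [icmat]

/-- The two complexifications of `γ ∈ SL(2, ℤ)` agree. [folklore] -/
theorem cmat_coe (γ : SL(2, ℤ)) : cmat (γ : GL (Fin 2) ℝ) = icmat γ := by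
  ext i j
  simp [cmat, icmat]

/-- `det γ = 1 > 0` in `GL(2, ℝ)`. [folklore] -/
theorem det_coe_pos (γ : SL(2, ℤ)) : 0 < (γ : GL (Fin 2) ℝ).det.val := by simp

variable (n)

/-- **The period cocycle** of `f ∈ S_{n+2}(Γ₀(N))` at `γ ∈ SL(2, ℤ)`, as a function of
`p = (u, v)`: `∫_τ^{i∞} (f|γ)(z)(zv - u)ⁿ dz - ∫_{γτ}^{i∞} f(z)(zv' - u')ⁿ dz`, `(u', v') = γ(u, v)`
(independent of `τ`, `periodFn_eq`). [cite: Shimura1971, §8.2 (8.2.20)] -/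
def periodFn (f : CuspForm (Gamma0 N) (n + 2)) (γ : SL(2, ℤ)) (p : Fin 2 → ℂ) : ℂ :=
  eichlerKernel n (⇑f ∣[(n + 2 : ℤ)] γ) UpperHalfPlane.I p -
    eichlerKernel n ⇑f (γ • UpperHalfPlane.I) ((icmat γ).mulVec p)

variable {n}

/-- The period cocycle may be computed at any base point. [folklore] -/
theorem periodFn_eq (f : CuspForm (Gamma0 N) (n + 2)) (γ : SL(2, ℤ)) (p : Fin 2 → ℂ) (τ : ℍ) :
    periodFn n f γ p = eichlerKernel n (⇑f ∣[(n + 2 : ℤ)] γ) τ p -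
      eichlerKernel n ⇑f (γ • τ) ((icmat γ).mulVec p) := by
  have hφ := isCuspFunction_one f
  have hψ : IsCuspFunction N (⇑f ∣[(n + 2 : ℤ)] (γ : GL (Fin 2) ℝ)) := isCuspFunction_slash f γ
  have := hφ.eichlerKernel_slash_sub_eq (det_coe_pos γ) hψ p UpperHalfPlane.I τ
  rw [cmat_coe] at this
  exact this

omit [NeZero N] in
/-- For `γ ∈ Γ₀(N)`, `f ∣ γ = f`. [folklore] -/
theorem slash_gamma0_eq_self (f : CuspForm (Gamma0 N) (n + 2)) (γ : Gamma0 N) :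
    ⇑f ∣[(n + 2 : ℤ)] (γ : SL(2, ℤ)) = ⇑f := by
  rw [ModularForm.SL_slash]
  exact SlashInvariantForm.slash_action_eqn f _
    (Subgroup.mem_map_of_mem (Matrix.SpecialLinearGroup.mapGL ℝ) γ.2)

/-- For `γ ∈ Γ₀(N)`: `periodFn = ∫_τ^{i∞} f(z)(zv - u)ⁿ dz - ∫_{γτ}^{i∞} f(z)(zv' - u')ⁿ dz`. [folklore] -/
theorem periodFn_eq_of_mem (f : CuspForm (Gamma0 N) (n + 2)) (γ : Gamma0 N) (p : Fin 2 → ℂ)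
    (τ : ℍ) : periodFn n f γ p =
      eichlerKernel n ⇑f τ p - eichlerKernel n ⇑f ((γ : SL(2, ℤ)) • τ) ((icmat γ).mulVec p) := by
  rw [periodFn_eq f γ p τ, slash_gamma0_eq_self]

/-- `c(1) = 0`. [folklore] -/
@[simp] theorem periodFn_one (f : CuspForm (Gamma0 N) (n + 2)) (p : Fin 2 → ℂ) :
    periodFn n f 1 p = 0 := by
  rw [periodFn_eq f 1 p UpperHalfPlane.I]
  simp

/-- **The cocycle relation** `c(γδ)(p) = c(δ)(p) + c(γ)(δp)` on `Γ₀(N)`. [cite: Shimura1971, §8.2 p. 233 (t(αβ) = t(α) + χ(α)t(β))] -/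
theorem periodFn_mul (f : CuspForm (Gamma0 N) (n + 2)) (γ δ : Gamma0 N) (p : Fin 2 → ℂ) :
    periodFn n f ((γ * δ : Gamma0 N) : SL(2, ℤ)) p =
      periodFn n f δ p + periodFn n f γ ((icmat δ).mulVec p) := by
  rw [periodFn_eq_of_mem f (γ * δ) p UpperHalfPlane.I, periodFn_eq_of_mem f δ p UpperHalfPlane.I,
    periodFn_eq_of_mem f γ _ ((δ : SL(2, ℤ)) • UpperHalfPlane.I)]
  have h1 : ((γ * δ : Gamma0 N) : SL(2, ℤ)) • UpperHalfPlane.I =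
      (γ : SL(2, ℤ)) • (δ : SL(2, ℤ)) • UpperHalfPlane.I := by
    rw [Subgroup.coe_mul, mul_smul]
  have h2 : (icmat ((γ * δ : Gamma0 N) : SL(2, ℤ))).mulVec p =
      (icmat γ).mulVec ((icmat δ).mulVec p) := by
    rw [Subgroup.coe_mul, icmat_mul, Matrix.mulVec_mulVec]
  rw [h1, h2]
  ring

/-- `c(γ⁻¹)(p) = -c(γ)(γ⁻¹p)`. [folklore] -/
theorem periodFn_inv (f : CuspForm (Gamma0 N) (n + 2)) (γ : Gamma0 N) (p : Fin 2 → ℂ) :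
    periodFn n f ((γ⁻¹ : Gamma0 N) : SL(2, ℤ)) p = -periodFn n f γ ((icmat ↑γ⁻¹).mulVec p) := by
  have := periodFn_mul f γ γ⁻¹ p
  rw [mul_inv_cancel, Subgroup.coe_one, periodFn_one] at this
  linear_combination -this

/-- Additivity in `f`. [folklore] -/
theorem periodFn_add (f g : CuspForm (Gamma0 N) (n + 2)) (γ : SL(2, ℤ)) (p : Fin 2 → ℂ) :
    periodFn n (f + g) γ p = periodFn n f γ p + periodFn n g γ p := by
  simp only [periodFn]
  have h1 : (⇑(f + g) : ℍ → ℂ) ∣[(n + 2 : ℤ)] γ = ⇑f ∣[(n + 2 : ℤ)] γ + ⇑g ∣[(n + 2 : ℤ)] γ := by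
    rw [CuspForm.coe_add, SlashAction.add_slash]
  rw [h1, (isCuspFunction_slash f γ).eichlerKernel_add (isCuspFunction_slash g γ),
    CuspForm.coe_add, (isCuspFunction_one f).eichlerKernel_add (isCuspFunction_one g)]
  ring

omit [NeZero N] in
/-- Homogeneity in `f`. [folklore] -/
theorem periodFn_smul (c : ℂ) (f : CuspForm (Gamma0 N) (n + 2)) (γ : SL(2, ℤ)) (p : Fin 2 → ℂ) :
    periodFn n (c • f) γ p = c * periodFn n f γ p := by
  simp only [periodFn]
  have h1 : (⇑(c • f) : ℍ → ℂ) ∣[(n + 2 : ℤ)] γ = c • (⇑f ∣[(n + 2 : ℤ)] γ) := by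
    rw [CuspForm.IsGLPos.coe_smul, ModularForm.SL_smul_slash]
  rw [h1, eichlerKernel_const_smul, CuspForm.IsGLPos.coe_smul, eichlerKernel_const_smul]
  ring

variable (n)

/-- **Period functionals**: `f ↦ c_f(γ)(u, v)` for `γ ∈ Γ₀(N)` and integers `u, v`. [cite: Shimura1971, §8.4 (8.4.1)] -/
def periodFunctionalK (γ : Gamma0 N) (q : Fin 2 → ℤ) :
    Module.Dual ℂ (CuspForm (Gamma0 N) (n + 2)) where
  toFun f := periodFn n f γ (fun i ↦ (q i : ℂ))
  map_add' f g := periodFn_add f g γ _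
  map_smul' c f := periodFn_smul c f γ _

/-- Unfolding `periodFunctionalK`. [folklore] -/
@[simp] theorem periodFunctionalK_apply (γ : Gamma0 N) (q : Fin 2 → ℤ)
    (f : CuspForm (Gamma0 N) (n + 2)) :
    periodFunctionalK n γ q f = periodFn n f γ (fun i ↦ (q i : ℂ)) := rfl

/-- **The Eichler–Shimura period lattice** in the dual of `S_{n+2}(Γ₀(N))`: the subgroup generated
by the period functionals `f ↦ c_f(γ)(u, v)`, `γ ∈ Γ₀(N)`, `u, v ∈ ℤ`. [cite: Shimura1971, §8.4 Prop. 8.6] -/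
def periodLatticeK : AddSubgroup (Module.Dual ℂ (CuspForm (Gamma0 N) (n + 2))) :=
  AddSubgroup.closure (Set.range fun γq : Gamma0 N × (Fin 2 → ℤ) ↦ periodFunctionalK n γq.1 γq.2)

variable {n}

/-- The generators lie in the period lattice. [folklore] -/
theorem periodFunctionalK_mem (γ : Gamma0 N) (q : Fin 2 → ℤ) :
    periodFunctionalK n γ q ∈ periodLatticeK (N := N) n :=
  AddSubgroup.subset_closure ⟨(γ, q), rfl⟩

/-- Integer matrices act on integer vectors: `(icmat γ) q` is the cast of an integer vector. [folklore] -/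
theorem icmat_mulVec_intCast (γ : SL(2, ℤ)) (q : Fin 2 → ℤ) :
    (icmat γ).mulVec (fun i ↦ (q i : ℂ)) =
      fun i ↦ (((γ : Matrix (Fin 2) (Fin 2) ℤ).mulVec q) i : ℂ) := by
  funext i
  simp [Matrix.mulVec, dotProduct, Fin.sum_univ_two]

/-- The cocycle relation for the functionals: `λ_{γδ,q} = λ_{δ,q} + λ_{γ,δq}`. [folklore] -/
theorem periodFunctionalK_mul (γ δ : Gamma0 N) (q : Fin 2 → ℤ) :
    periodFunctionalK n (γ * δ) q =
      periodFunctionalK n δ q +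
        periodFunctionalK n γ (((δ : SL(2, ℤ)) : Matrix (Fin 2) (Fin 2) ℤ).mulVec q) := by
  ext f
  simp only [periodFunctionalK_apply, LinearMap.add_apply]
  rw [periodFn_mul, icmat_mulVec_intCast]

/-- The cocycle relation at an inverse: `λ_{γ⁻¹,q} = -λ_{γ,γ⁻¹q}`. [folklore] -/
theorem periodFunctionalK_inv (γ : Gamma0 N) (q : Fin 2 → ℤ) :
    periodFunctionalK n γ⁻¹ q =
      -periodFunctionalK n γ
        ((((γ⁻¹ : Gamma0 N) : SL(2, ℤ)) : Matrix (Fin 2) (Fin 2) ℤ).mulVec q) := by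
  ext f
  simp only [periodFunctionalK_apply, LinearMap.neg_apply]
  rw [periodFn_inv, icmat_mulVec_intCast]

end Cocycle

/-! ### The period lattice is finitely generated -/

section FG

variable {N : ℕ} [NeZero N] (n : ℕ)

/-- Elementary functionals `f ↦ C(n,j) ∫_I^{i∞} (f|γ)(z) zʲ dz`. [folklore] -/
def momentFunctional (γ : SL(2, ℤ)) (j : ℕ) : Module.Dual ℂ (CuspForm (Gamma0 N) (n + 2)) where
  toFun f := (n.choose j : ℂ) * powPrimitive j (⇑f ∣[(n + 2 : ℤ)] γ) UpperHalfPlane.I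
  map_add' f g := by
    have h1 : (⇑(f + g) : ℍ → ℂ) ∣[(n + 2 : ℤ)] γ = ⇑f ∣[(n + 2 : ℤ)] γ + ⇑g ∣[(n + 2 : ℤ)] γ := by
      rw [CuspForm.coe_add, SlashAction.add_slash]
    rw [h1, (isCuspFunction_slash f γ).powPrimitive_add j (isCuspFunction_slash g γ)]
    ring
  map_smul' c f := by
    have h1 : (⇑(c • f) : ℍ → ℂ) ∣[(n + 2 : ℤ)] γ = c • (⇑f ∣[(n + 2 : ℤ)] γ) := by
      rw [CuspForm.IsGLPos.coe_smul, ModularForm.SL_smul_slash]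
    rw [h1, powPrimitive_const_smul]
    simp only [RingHom.id_apply, smul_eq_mul]
    ring

/-- Elementary functionals `f ↦ C(n,j) ∫_{γI}^{i∞} f(z) zʲ dz`. [folklore] -/
def momentFunctional' (γ : SL(2, ℤ)) (j : ℕ) : Module.Dual ℂ (CuspForm (Gamma0 N) (n + 2)) where
  toFun f := (n.choose j : ℂ) * powPrimitive j ⇑f (γ • UpperHalfPlane.I)
  map_add' f g := by
    rw [CuspForm.coe_add, (isCuspFunction_one f).powPrimitive_add j (isCuspFunction_one g)]
    ring
  map_smul' c f := by
    rw [CuspForm.IsGLPos.coe_smul, powPrimitive_const_smul]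
    simp only [RingHom.id_apply, smul_eq_mul]
    ring

variable {n}

/-- The period functional `λ_{γ,q}` is an integral combination of the `2(n+1)` moment
functionals of `γ`. [folklore] -/
theorem periodFunctionalK_eq_sum (γ : Gamma0 N) (q : Fin 2 → ℤ) :
    periodFunctionalK n γ q =
      ∑ j ∈ Finset.range (n + 1),
        (q 1 ^ j * (-(q 0)) ^ (n - j)) • momentFunctional n (γ : SL(2, ℤ)) j -
      ∑ j ∈ Finset.range (n + 1),
        ((((γ : SL(2, ℤ)) : Matrix (Fin 2) (Fin 2) ℤ).mulVec q 1) ^ j *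
          (-(((γ : SL(2, ℤ)) : Matrix (Fin 2) (Fin 2) ℤ).mulVec q 0)) ^ (n - j)) •
          momentFunctional' n (γ : SL(2, ℤ)) j := by
  ext f
  simp only [periodFunctionalK_apply, periodFn, eichlerKernel, LinearMap.sub_apply,
    LinearMap.coe_sum, Finset.sum_apply, LinearMap.smul_apply, icmat_mulVec_intCast]
  congr 1
  · refine Finset.sum_congr rfl fun j _ ↦ ?_
    simp only [momentFunctional, LinearMap.coe_mk, AddHom.coe_mk, zsmul_eq_mul]
    push_cast
    ring
  · refine Finset.sum_congr rfl fun j _ ↦ ?_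
    simp only [momentFunctional', LinearMap.coe_mk, AddHom.coe_mk, zsmul_eq_mul]
    push_cast
    ring

/-- Hence `λ_{γ,q}` lies in any subgroup containing the moment functionals of `γ`. [folklore] -/
theorem periodFunctionalK_mem_of_moment_mem (γ : Gamma0 N) (q : Fin 2 → ℤ)
    (L : AddSubgroup (Module.Dual ℂ (CuspForm (Gamma0 N) (n + 2))))
    (h1 : ∀ j ∈ Finset.range (n + 1), momentFunctional n (γ : SL(2, ℤ)) j ∈ L)
    (h2 : ∀ j ∈ Finset.range (n + 1), momentFunctional' n (γ : SL(2, ℤ)) j ∈ L) :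
    periodFunctionalK n γ q ∈ L := by
  rw [periodFunctionalK_eq_sum]
  refine sub_mem (AddSubgroup.sum_mem _ fun j hj ↦ AddSubgroup.zsmul_mem _ (h1 j hj) _)
    (AddSubgroup.sum_mem _ fun j hj ↦ AddSubgroup.zsmul_mem _ (h2 j hj) _)

variable (N n) in
/-- **The Eichler–Shimura period lattice of `S_{n+2}(Γ₀(N))` is finitely generated**: `Γ₀(N)` is
finitely generated, the cocycle relation reduces every `λ_{γ,q}` to the generators (and their
inverses), and each `λ_{s,q}` is an integral combination of finitely many moment functionals. [cite: Shimura1971, Prop. 8.6 (proof), p. 239] -/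
theorem periodLatticeK_fg : (periodLatticeK (N := N) n).FG := by
  classical
  obtain ⟨S, hS⟩ := Group.fg_def.mp (inferInstance : Group.FG (Gamma0 N))
  -- the finite set of moment functionals of the generators
  let T : Finset (Module.Dual ℂ (CuspForm (Gamma0 N) (n + 2))) :=
    S.biUnion fun s ↦ (Finset.range (n + 1)).biUnion fun j ↦
      {momentFunctional n (s : SL(2, ℤ)) j, momentFunctional' n (s : SL(2, ℤ)) j}
  let L : Submodule ℤ (Module.Dual ℂ (CuspForm (Gamma0 N) (n + 2))) :=
    Submodule.span ℤ (T : Set _)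
  haveI : Module.Finite ℤ L := Module.Finite.span_of_finite ℤ T.finite_toSet
  have hT : ∀ s ∈ S, ∀ j ∈ Finset.range (n + 1),
      momentFunctional n (s : SL(2, ℤ)) j ∈ L.toAddSubgroup ∧
        momentFunctional' n (s : SL(2, ℤ)) j ∈ L.toAddSubgroup := by
    intro s hs j hj
    have hsub : ∀ φ ∈ T, φ ∈ L.toAddSubgroup := fun φ hφ ↦ Submodule.subset_span hφ
    constructor <;> apply hsub <;> simp only [T, Finset.mem_biUnion, Finset.mem_insert,
      Finset.mem_singleton] <;> exact ⟨s, hs, j, hj, by simp⟩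
  -- every `λ_{γ,q}` lies in `L`
  have hmem : ∀ (γ : Gamma0 N) (q : Fin 2 → ℤ), periodFunctionalK n γ q ∈ L.toAddSubgroup := by
    intro γ
    have hγ : γ ∈ Subgroup.closure (S : Set (Gamma0 N)) := by rw [hS]; trivial
    induction hγ using Subgroup.closure_induction with
    | mem s hs =>
      intro q
      exact periodFunctionalK_mem_of_moment_mem s q _ (fun j hj ↦ (hT s hs j hj).1)
        (fun j hj ↦ (hT s hs j hj).2)
    | one =>
      intro q
      have : periodFunctionalK n (1 : Gamma0 N) q = 0 := by
        ext f; simp [periodFunctionalK_apply]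
      rw [this]
      exact zero_mem _
    | mul x y _ _ hx hy =>
      intro q
      rw [periodFunctionalK_mul]
      exact add_mem (hy q) (hx _)
    | inv x _ hx =>
      intro q
      rw [periodFunctionalK_inv]
      exact neg_mem (hx _)
  have hle : (periodLatticeK (N := N) n).toIntSubmodule ≤ L := by
    intro φ hφ
    have hφ' : φ ∈ periodLatticeK (N := N) n := hφ
    refine (AddSubgroup.closure_le L.toAddSubgroup).mpr ?_ hφ'
    rintro _ ⟨⟨γ, q⟩, rfl⟩
    exact hmem γ q
  have hfin : Module.Finite ℤ (periodLatticeK (N := N) n).toIntSubmodule :=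
    Module.Finite.of_injective (Submodule.inclusion hle) (Submodule.inclusion_injective hle)
  have := (Module.Finite.iff_fg).mp hfin
  rwa [Submodule.fg_iff_addSubgroup_fg, AddSubgroup.toIntSubmodule_toAddSubgroup] at this

end FG

/-! ### Two lemmas on polynomials -/

section PolyLemmas

/-- A complex polynomial tending to `0` upwards along a vertical line is zero. [folklore] -/
theorem Polynomial.eq_zero_of_tendsto_vertical (R : Polynomial ℂ) (x₀ : ℝ)
    (h : Tendsto (fun y : ℝ ↦ R.eval ((x₀ : ℂ) + y * I)) atTop (𝓝 0)) : R = 0 := by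
  by_contra hR
  rcases lt_or_ge 0 R.degree with hdeg | hdeg
  · have hz : Tendsto (fun y : ℝ ↦ ‖((x₀ : ℂ) + y * I)‖) atTop atTop := by
      refine tendsto_atTop_mono (fun y ↦ ?_) tendsto_id
      have h1 := Complex.abs_im_le_norm ((x₀ : ℂ) + y * I)
      simp only [Complex.add_im, Complex.ofReal_im, Complex.mul_im, Complex.ofReal_re,
        Complex.I_im, mul_one, Complex.I_re, mul_zero, add_zero, zero_add] at h1
      exact (le_abs_self y).trans h1
    have h2 := R.tendsto_norm_atTop hdeg hz
    have h3 : Tendsto (fun y : ℝ ↦ ‖R.eval ((x₀ : ℂ) + y * I)‖) atTop (𝓝 0) := by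
      simpa using h.norm
    exact (h3.not_tendsto (disjoint_nhds_atTop 0)) h2
  · have hC := Polynomial.eq_C_of_degree_le_zero hdeg
    have hc0 : R.coeff 0 ≠ 0 := fun h0 ↦ hR (by rw [hC, h0, map_zero])
    rw [hC] at h
    simp only [Polynomial.eval_C] at h
    exact hc0 (tendsto_nhds_unique tendsto_const_nhds h)

/-- A periodic complex polynomial is constant. [folklore] -/
theorem Polynomial.eval_eq_eval_zero_of_periodic (R : Polynomial ℂ) {T : ℂ} (hT : T ≠ 0)
    (h : ∀ t : ℂ, R.eval (t + T) = R.eval t) (t : ℂ) : R.eval t = R.eval 0 := by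
  have hnat : ∀ m : ℕ, R.eval (m * T) = R.eval 0 := by
    intro m
    induction m with
    | zero => simp
    | succ m ih => rw [Nat.cast_succ, add_mul, one_mul, h, ih]
  have hroots : Set.Infinite {x | Polynomial.IsRoot (R - Polynomial.C (R.eval 0)) x} := by
    have hinj : Function.Injective fun m : ℕ ↦ (m : ℂ) * T := fun a b hab ↦ by
      have := mul_right_cancel₀ hT hab
      exact_mod_cast this
    refine Set.infinite_of_injective_forall_mem hinj fun m ↦ ?_
    simp [hnat m]
  have h0 := Polynomial.eq_zero_of_infinite_isRoot _ hroots
  have := congrArg (Polynomial.eval t) h0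
  simpa [sub_eq_zero] using this

end PolyLemmas

/-! ### Homogeneity of the kernel and the diagonal `F(τ) = ∫_τ^{i∞} φ(z)(z - τ)ⁿ dz` -/

section Diagonal

variable {n : ℕ} {h : ℝ} {φ : ℍ → ℂ}

/-- The kernel is homogeneous of degree `n` in `(u, v)`. [folklore] -/
theorem eichlerKernel_smul_arg (n : ℕ) (φ : ℍ → ℂ) (τ : ℍ) (c : ℂ) (p : Fin 2 → ℂ) :
    eichlerKernel n φ τ (c • p) = c ^ n * eichlerKernel n φ τ p := by
  simp only [eichlerKernel, Finset.mul_sum, Pi.smul_apply, smul_eq_mul]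
  refine Finset.sum_congr rfl fun j hj ↦ ?_
  have hjn : j ≤ n := Nat.lt_succ_iff.mp (Finset.mem_range.mp hj)
  have : c ^ n = c ^ j * c ^ (n - j) := by rw [← pow_add, Nat.add_sub_cancel' hjn]
  rw [this, show -(c * p 0) = c * (-(p 0)) by ring, mul_pow, mul_pow]
  ring

/-- `γ (z, 1) = (cz + d) (γz, 1)` for `γ ∈ SL(2, ℤ)`. [folklore] -/
theorem icmat_mulVec_vecCons (γ : SL(2, ℤ)) {z : ℂ} (hz : 0 < z.im) :
    (icmat γ).mulVec ![z, 1] = ((γ 1 0 : ℤ) * z + (γ 1 1 : ℤ)) • ![moebius γ z, 1] := by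
  have hd := moebius_denom_ne_zero γ hz
  funext i
  fin_cases i
  · simp [Matrix.mulVec, dotProduct, Fin.sum_univ_two, moebius]
    rw [mul_div_cancel₀ _ hd]
  · simp [Matrix.mulVec, dotProduct, Fin.sum_univ_two]

/-- `d/dw ∫_w^{i∞} φ(z) dz = -φ(w)` (the kernel with `n = 0` on the diagonal). [folklore] -/
theorem IsCuspFunction.hasDerivAt_eichlerKernel_diag_zero (hφ : IsCuspFunction h φ) {z : ℂ}
    (hz : 0 < z.im) :
    HasDerivAt (fun w : ℂ ↦ eichlerKernel 0 φ (ofComplex w) ![w, 1]) (-φ (ofComplex z)) z := by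
  have : (fun w : ℂ ↦ eichlerKernel 0 φ (ofComplex w) ![w, 1]) =
      fun w ↦ eichlerPrimitive φ (ofComplex w) := by
    funext w; simp [eichlerKernel]
  rw [this]
  exact hφ.hasDerivAt_eichlerPrimitive hz

/-- **`d/dw ∫_w^{i∞} φ(z)(z - w)^{m+1} dz = -(m+1) ∫_w^{i∞} φ(z)(z - w)^m dz`.** [folklore] -/
theorem IsCuspFunction.hasDerivAt_eichlerKernel_diag_succ (hφ : IsCuspFunction h φ) (m : ℕ)
    {z : ℂ} (hz : 0 < z.im) :
    HasDerivAt (fun w : ℂ ↦ eichlerKernel (m + 1) φ (ofComplex w) ![w, 1])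
      (-((m + 1 : ℕ) : ℂ) * eichlerKernel m φ (ofComplex z) ![z, 1]) z := by
  -- derivative of each term `C(m+1,j) I_j(w) (-w)^{m+1-j}`
  have hterm : ∀ j ∈ Finset.range (m + 1 + 1), HasDerivAt
      (fun w : ℂ ↦ ((m + 1).choose j : ℂ) * (powPrimitive j φ (ofComplex w) *
        (-w) ^ (m + 1 - j)))
      (((m + 1).choose j : ℂ) * ((-(φ (ofComplex z) * z ^ j)) * (-z) ^ (m + 1 - j) +
        powPrimitive j φ (ofComplex z) * (((m + 1 - j : ℕ) : ℂ) * (-z) ^ (m - j) * (-1)))) z := by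
    intro j _
    have h1 := hφ.hasDerivAt_powPrimitive j hz
    have h2 : HasDerivAt (fun w : ℂ ↦ (-w) ^ (m + 1 - j))
        (((m + 1 - j : ℕ) : ℂ) * (-z) ^ (m - j) * (-1)) z := by
      have := (hasDerivAt_neg z).pow (m + 1 - j)
      refine this.congr_deriv ?_
      rw [show m + 1 - j - 1 = m - j by omega]
    exact (h1.fun_mul h2).const_mul ((m + 1).choose j : ℂ)
  have H := HasDerivAt.fun_sum hterm
  have hfun : (fun w : ℂ ↦ eichlerKernel (m + 1) φ (ofComplex w) ![w, 1]) =
      fun w ↦ ∑ j ∈ Finset.range (m + 1 + 1), ((m + 1).choose j : ℂ) *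
        (powPrimitive j φ (ofComplex w) * (-w) ^ (m + 1 - j)) := by
    funext w
    simp only [eichlerKernel, Matrix.cons_val_one, Matrix.cons_val_zero,
      one_pow, mul_one, mul_assoc]
  rw [hfun]
  refine H.congr_deriv ?_
  -- the algebra
  simp only [mul_add, Finset.sum_add_distrib]
  have hA : ∑ j ∈ Finset.range (m + 1 + 1),
      ((m + 1).choose j : ℂ) * (-(φ (ofComplex z) * z ^ j) * (-z) ^ (m + 1 - j)) = 0 := by
    have := (add_pow z (-z) (m + 1)).symm
    rw [add_neg_cancel, zero_pow (Nat.succ_ne_zero m)] at this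
    calc ∑ j ∈ Finset.range (m + 1 + 1),
          ((m + 1).choose j : ℂ) * (-(φ (ofComplex z) * z ^ j) * (-z) ^ (m + 1 - j))
        = -φ (ofComplex z) * ∑ j ∈ Finset.range (m + 1 + 1),
            z ^ j * (-z) ^ (m + 1 - j) * ((m + 1).choose j : ℂ) := by
          rw [Finset.mul_sum]
          exact Finset.sum_congr rfl fun j _ ↦ by ring
      _ = 0 := by rw [this, mul_zero]
  have hB : ∑ j ∈ Finset.range (m + 1 + 1), ((m + 1).choose j : ℂ) *
      (powPrimitive j φ (ofComplex z) * (((m + 1 - j : ℕ) : ℂ) * (-z) ^ (m - j) * (-1))) =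
      -((m + 1 : ℕ) : ℂ) * eichlerKernel m φ (ofComplex z) ![z, 1] := by
    rw [Finset.sum_range_succ, Nat.sub_self, Nat.cast_zero, zero_mul, zero_mul, mul_zero,
      mul_zero, add_zero]
    simp only [eichlerKernel, Finset.mul_sum, Matrix.cons_val_one,
      Matrix.cons_val_zero, one_pow, mul_one]
    refine Finset.sum_congr rfl fun j hj ↦ ?_
    have hjm : j ≤ m := Nat.lt_succ_iff.mp (Finset.mem_range.mp hj)
    have key : (((m + 1).choose j : ℕ) : ℂ) * ((m + 1 - j : ℕ) : ℂ) =
        ((m + 1 : ℕ) : ℂ) * (m.choose j : ℂ) := by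
      have h' : (m + 1).choose j * (m + 1 - j) = (m + 1) * m.choose j := by
        rw [← Nat.choose_mul_succ_eq m j, mul_comm]
      exact_mod_cast h'
    calc ((m + 1).choose j : ℂ) * (powPrimitive j φ (ofComplex z) *
          (((m + 1 - j : ℕ) : ℂ) * (-z) ^ (m - j) * (-1)))
        = -((((m + 1).choose j : ℕ) : ℂ) * ((m + 1 - j : ℕ) : ℂ)) *
            powPrimitive j φ (ofComplex z) * (-z) ^ (m - j) := by ring
      _ = -((m + 1 : ℕ) : ℂ) * ((m.choose j : ℂ) * powPrimitive j φ (ofComplex z) *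
            (-z) ^ (m - j)) := by rw [key]; ring
  rw [hA, hB, zero_add]

/-- **If `F_m(τ) = ∫_τ^{i∞} φ(z)(z - τ)^m dz` is constant on `ℍ` then `φ = 0`**
(`F_m' = -m F_{m-1}`, …, `F_0' = -φ`). [folklore] -/
theorem IsCuspFunction.eq_zero_of_eichlerKernel_diag_const (hφ : IsCuspFunction h φ) (m : ℕ) :
    (∃ c : ℂ, ∀ z : ℂ, 0 < z.im → eichlerKernel m φ (ofComplex z) ![z, 1] = c) →
      ∀ τ : ℍ, φ τ = 0 := by
  induction m with
  | zero =>
    rintro ⟨c, hc⟩ τ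
    have h1 := hφ.hasDerivAt_eichlerKernel_diag_zero τ.im_pos
    have h2 : HasDerivAt (fun w : ℂ ↦ eichlerKernel 0 φ (ofComplex w) ![w, 1]) 0 (τ : ℂ) := by
      refine (hasDerivAt_const (τ : ℂ) c).congr_of_eventuallyEq ?_
      filter_upwards [isOpen_upperHalfPlaneSet.mem_nhds τ.im_pos] with w hw
      exact hc w hw
    have := h1.unique h2
    rw [ofComplex_apply] at this
    exact neg_eq_zero.mp this
  | succ m ih =>
    rintro ⟨c, hc⟩
    apply ih
    refine ⟨0, fun z hz ↦ ?_⟩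
    have h1 := hφ.hasDerivAt_eichlerKernel_diag_succ m hz
    have h2 : HasDerivAt (fun w : ℂ ↦ eichlerKernel (m + 1) φ (ofComplex w) ![w, 1]) 0 z := by
      refine (hasDerivAt_const z c).congr_of_eventuallyEq ?_
      filter_upwards [isOpen_upperHalfPlaneSet.mem_nhds hz] with w hw
      exact hc w hw
    have := h1.unique h2
    have hm : (-((m + 1 : ℕ) : ℂ)) ≠ 0 := by
      rw [neg_ne_zero]; exact_mod_cast Nat.succ_ne_zero m
    exact (mul_eq_zero.mp this).resolve_left hm

end Diagonal

/-! ### Eichler–Shimura injectivity: a cusp form with vanishing periods is zero -/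

section Separation

variable {N : ℕ} [NeZero N] {n : ℕ}

variable (n) in
/-- The weight `-n` **Eichler integral** `F_f(τ) = ∫_τ^{i∞} f(z)(z - τ)ⁿ dz` of
`f ∈ S_{n+2}(Γ₀(N))`. [folklore] -/
def eichlerIntegralK (f : CuspForm (Gamma0 N) (n + 2)) (τ : ℍ) : ℂ :=
  eichlerKernel n ⇑f τ ![(τ : ℂ), 1]

omit [NeZero N] in
/-- `(γτ : ℂ) = moebius γ τ`. [folklore] -/
theorem coe_sl_smul (γ : SL(2, ℤ)) (τ : ℍ) : ((γ • τ : ℍ) : ℂ) = moebius γ τ := by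
  rw [← ofComplex_apply τ, coe_smul_ofComplex γ τ.im_pos, ofComplex_apply]

/-- **The weight `-n` action on the Eichler integral produces the period polynomial**:
`(F_f ∣[-n] γ)(τ) = ∫_τ^{i∞} (f|γ)(z)(z - τ)ⁿ dz - c_f(γ)(τ, 1)` for `γ ∈ SL(2, ℤ)`. [folklore] -/
theorem eichlerIntegralK_slash_apply (f : CuspForm (Gamma0 N) (n + 2)) (γ : SL(2, ℤ)) (τ : ℍ) :
    (eichlerIntegralK n f ∣[(-(n : ℤ))] γ) τ =
      eichlerKernel n (⇑f ∣[(n + 2 : ℤ)] γ) τ ![(τ : ℂ), 1] - periodFn n f γ ![(τ : ℂ), 1] := by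
  rw [periodFn_eq f γ _ τ, icmat_mulVec_vecCons γ τ.im_pos, eichlerKernel_smul_arg,
    ← coe_sl_smul, ModularForm.SL_slash_apply, neg_neg, zpow_natCast, eichlerIntegralK,
    ModularGroup.denom_apply]
  ring

/-- If the periods of `γ ∈ Γ₀(N)` vanish then `F_f ∣[-n] γ = F_f`. [folklore] -/
theorem eichlerIntegralK_slash_eq_self (f : CuspForm (Gamma0 N) (n + 2)) (γ : Gamma0 N)
    (hγ : ∀ p, periodFn n f γ p = 0) :
    eichlerIntegralK n f ∣[(-(n : ℤ))] (γ : SL(2, ℤ)) = eichlerIntegralK n f := by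
  funext τ
  rw [eichlerIntegralK_slash_apply, hγ, sub_zero, slash_gamma0_eq_self]
  rfl

/-- The Eichler integral is holomorphic. [folklore] -/
theorem mdifferentiable_eichlerIntegralK (f : CuspForm (Gamma0 N) (n + 2)) :
    MDifferentiable 𝓘(ℂ) 𝓘(ℂ) (eichlerIntegralK n f) := by
  rw [UpperHalfPlane.mdifferentiable_iff]
  have h : ∀ z : ℂ, 0 < z.im →
      DifferentiableAt ℂ (fun w ↦ eichlerKernel n ⇑f (ofComplex w) ![w, 1]) z := by
    intro z hz
    cases n with
    | zero => exact ((isCuspFunction_one f).hasDerivAt_eichlerKernel_diag_zero hz).differentiableAt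
    | succ m =>
      exact ((isCuspFunction_one f).hasDerivAt_eichlerKernel_diag_succ m hz).differentiableAt
  intro z hz
  refine (h z hz).differentiableWithinAt.congr (fun w (hw : 0 < w.im) ↦ ?_) ?_
  · simp [eichlerIntegralK, ofComplex_apply_of_im_pos hw]
  · simp [eichlerIntegralK, ofComplex_apply_of_im_pos hz]

omit [NeZero N] in
/-- `γ (t, 1) = (a t + b, c t + d)`. [folklore] -/
theorem icmat_mulVec_vecCons' (γ : SL(2, ℤ)) (t : ℂ) :
    (icmat γ).mulVec ![t, 1] =
      ![(γ 0 0 : ℤ) * t + (γ 0 1 : ℤ), (γ 1 0 : ℤ) * t + (γ 1 1 : ℤ)] := by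
  funext i
  fin_cases i <;> simp [Matrix.mulVec, dotProduct, Fin.sum_univ_two]

/-- `((ofComplex z : ℍ) : ℂ) = z` for `im z > 0`. [folklore] -/
theorem coe_ofComplex {z : ℂ} (hz : 0 < z.im) : ((ofComplex z : ℍ) : ℂ) = z := by
  rw [ofComplex_apply_of_im_pos hz]

omit [NeZero N] in
/-- The period function on the line `(t, 1)` is a polynomial in `t`. [folklore] -/
theorem exists_polynomial_periodFn (f : CuspForm (Gamma0 N) (n + 2)) (γ : SL(2, ℤ)) :
    ∃ R : Polynomial ℂ, ∀ t : ℂ, periodFn n f γ ![t, 1] = R.eval t := by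
  refine ⟨∑ j ∈ Finset.range (n + 1), Polynomial.C ((n.choose j : ℂ) *
      powPrimitive j (⇑f ∣[(n + 2 : ℤ)] γ) UpperHalfPlane.I) * (-Polynomial.X) ^ (n - j) -
    ∑ j ∈ Finset.range (n + 1), Polynomial.C ((n.choose j : ℂ) *
      powPrimitive j ⇑f (γ • UpperHalfPlane.I)) *
      (Polynomial.C ((γ 1 0 : ℤ) : ℂ) * Polynomial.X + Polynomial.C ((γ 1 1 : ℤ) : ℂ)) ^ j *
      (-(Polynomial.C ((γ 0 0 : ℤ) : ℂ) * Polynomial.X + Polynomial.C ((γ 0 1 : ℤ) : ℂ))) ^ (n - j),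
    fun t ↦ ?_⟩
  simp only [periodFn, eichlerKernel, icmat_mulVec_vecCons', Polynomial.eval_sub,
    Polynomial.eval_finsetSum, Polynomial.eval_mul, Polynomial.eval_C, Polynomial.eval_pow,
    Polynomial.eval_neg, Polynomial.eval_X, Polynomial.eval_add, Matrix.cons_val_one,
    Matrix.cons_val_zero]
  congr 1
  refine Finset.sum_congr rfl fun j _ ↦ ?_
  ring

omit [NeZero N] in
/-- `T^N` acts by `τ ↦ τ + N`, with trivial automorphy factor. [folklore] -/
theorem slash_T_zpow_apply (F : ℍ → ℂ) (k : ℤ) (τ : ℍ) :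
    (F ∣[k] (ModularGroup.T ^ (N : ℤ))) τ = F (ModularGroup.T ^ (N : ℤ) • τ) := by
  rw [ModularForm.SL_slash_apply, ModularGroup.denom_apply, ModularGroup.coe_T_zpow]
  simp

/-- **Boundedness of `F_f ∣[-n] g` at `∞`** for every `g ∈ SL(2, ℤ)`, when all periods of
`Γ₀(N)` vanish: `F_f ∣ g = G - P` with `G(τ) = ∫_τ^{i∞} (f|g)(z)(z-τ)ⁿ dz → 0` and `P` a
polynomial; `F_f ∣ g` is `N`-periodic (`g Tᴺ g⁻¹ ∈ Γ₀(N)`), hence so is `P` up to `o(1)`, so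
`P` is constant; and a periodic function bounded on a period strip is bounded. [cite: Shimura1971, §8.2 p. 233 (the limit F(s) at a cusp)] -/
theorem isBoundedAtImInfty_eichlerIntegralK_slash (f : CuspForm (Gamma0 N) (n + 2))
    (hper : ∀ (γ : Gamma0 N) (p : Fin 2 → ℂ), periodFn n f γ p = 0) (g : SL(2, ℤ)) :
    IsBoundedAtImInfty (eichlerIntegralK n f ∣[(-(n : ℤ))] g) := by
  set ψ : ℍ → ℂ := ⇑f ∣[(n + 2 : ℤ)] g with hψdef
  have hψ : IsCuspFunction N ψ := isCuspFunction_slash f g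
  set Fg : ℍ → ℂ := eichlerIntegralK n f ∣[(-(n : ℤ))] g with hFgdef
  obtain ⟨R, hR⟩ := exists_polynomial_periodFn f g
  -- (a) `Fg = G - P`
  have ha : ∀ τ : ℍ, Fg τ = eichlerKernel n ψ τ ![(τ : ℂ), 1] - R.eval (τ : ℂ) := fun τ ↦ by
    rw [hFgdef, eichlerIntegralK_slash_apply, hR]
  -- (c) `Fg` is `N`-periodic
  have hT : ∀ τ : ℍ, Fg (ModularGroup.T ^ (N : ℤ) • τ) = Fg τ := by
    intro τ
    have hmem := conj_T_zpow_mem_Gamma0 (N := N) g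
    have h1 := eichlerIntegralK_slash_eq_self f ⟨_, hmem⟩ (hper ⟨_, hmem⟩)
    have h2 : Fg ∣[(-(n : ℤ))] (ModularGroup.T ^ (N : ℤ)) = Fg := by
      rw [hFgdef, ← SlashAction.slash_mul]
      conv_rhs => rw [← h1, ← SlashAction.slash_mul]
      congr 1
      simp [mul_assoc]
    rw [← slash_T_zpow_apply Fg (-(n : ℤ)) τ, h2]
  have hTc : ∀ {z : ℂ} (hz : 0 < z.im), ModularGroup.T ^ (N : ℤ) • ofComplex z =
      ofComplex (z + N) := by
    intro z hz
    have hz' : 0 < (z + N).im := by simpa using hz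
    ext1
    rw [ModularGroup.coe_T_zpow_smul_eq, ofComplex_apply_of_im_pos hz,
      ofComplex_apply_of_im_pos hz']
    simp
  -- (f) `R` is constant
  have hRper : ∀ t : ℂ, R.eval (t + N) = R.eval t := by
    set S : Polynomial ℂ := R.comp (Polynomial.X + Polynomial.C (N : ℂ)) - R
    have hS : ∀ t, S.eval t = R.eval (t + N) - R.eval t := fun t ↦ by
      simp [S, Polynomial.eval_comp]
    suffices S = 0 by
      intro t
      have := hS t
      rw [‹S = 0›, Polynomial.eval_zero] at this
      exact sub_eq_zero.mp this.symm
    apply Polynomial.eq_zero_of_tendsto_vertical S 0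
    have hlim := (hψ.tendsto_eichlerKernel_diag_atTop (n := n) N).sub
      (hψ.tendsto_eichlerKernel_diag_atTop (n := n) 0)
    rw [sub_zero] at hlim
    refine hlim.congr' ?_
    filter_upwards [eventually_gt_atTop (0 : ℝ)] with y hy
    have hz : 0 < (((0 : ℝ) : ℂ) + y * I).im := by simpa using hy
    have hzN : 0 < (((N : ℝ) : ℂ) + y * I).im := by simpa using hy
    have e1 := ha (ofComplex (((0 : ℝ) : ℂ) + y * I))
    have e2 := ha (ofComplex (((N : ℝ) : ℂ) + y * I))
    have e3 := hT (ofComplex (((0 : ℝ) : ℂ) + y * I))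
    have e4 : (((0 : ℝ) : ℂ) + y * I) + N = ((N : ℝ) : ℂ) + y * I := by push_cast; ring
    rw [hTc hz, e4] at e3
    rw [coe_ofComplex hz] at e1
    rw [coe_ofComplex hzN] at e2
    rw [hS, e4]
    linear_combination e1 - e2 + e3
  have hRconst : ∀ t : ℂ, R.eval t = R.eval 0 :=
    Polynomial.eval_eq_eval_zero_of_periodic R (by exact_mod_cast NeZero.ne N) hRper
  -- (e) the bound for `G` on the strip
  obtain ⟨C, hC0, hC⟩ := hψ.exists_norm_eichlerKernel_le (n := n)
  have hNpos : (0 : ℝ) < N := by exact_mod_cast Nat.pos_of_ne_zero (NeZero.ne N)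
  have ha' : 0 < 2 * Real.pi / N := by positivity
  have hlim := (tendsto_affine_pow_mul_exp_neg_atTop (2 * (1 + N)) 2 n ha').const_mul C
  rw [mul_zero] at hlim
  obtain ⟨A₀, hA₀⟩ := (hlim.eventually (ge_mem_nhds zero_lt_one)).exists_forall_of_atTop
  -- conclusion
  rw [isBoundedAtImInfty_iff]
  refine ⟨1 + ‖R.eval 0‖, max A₀ 1, fun τ hτ ↦ ?_⟩
  have hy1 : 1 ≤ τ.im := le_trans (le_max_right _ _) hτ
  have hyA : A₀ ≤ τ.im := le_trans (le_max_left _ _) hτ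
  -- reduce `re τ` modulo `N`
  have hperx : Function.Periodic (fun u : ℝ ↦ Fg (ofComplex (u + τ.im * I))) N := by
    intro u
    have hz : 0 < ((u : ℂ) + τ.im * I).im := by simpa using τ.im_pos
    have := hT (ofComplex ((u : ℂ) + τ.im * I))
    rw [hTc hz] at this
    simp only
    rw [← this]
    congr 2
    push_cast
    ring
  obtain ⟨x', hx', hxeq⟩ := hperx.exists_mem_Ico₀ hNpos τ.re
  have hττ : τ = ofComplex ((τ.re : ℂ) + τ.im * I) := by
    ext1
    rw [ofComplex_apply_of_im_pos (by simpa using τ.im_pos)]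
    apply Complex.ext <;> simp
  have hz' : 0 < ((x' : ℂ) + τ.im * I).im := by simpa using τ.im_pos
  set τ' : ℍ := ofComplex ((x' : ℂ) + τ.im * I) with hτ'
  have hτ'im : τ'.im = τ.im := by
    rw [hτ', ← UpperHalfPlane.coe_im, ofComplex_apply_of_im_pos hz']; simp
  have hτ're : τ'.re = x' := by
    rw [hτ', ← UpperHalfPlane.coe_re, ofComplex_apply_of_im_pos hz']; simp
  have hval : Fg τ = Fg τ' := by
    conv_lhs => rw [hττ]
    exact hxeq
  rw [hval, ha τ', hRconst]
  refine (norm_sub_le _ _).trans (add_le_add ?_ le_rfl)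
  -- `‖G τ'‖ ≤ C (2(1+N+y))ⁿ e^{-a y} ≤ 1`
  have hG := hC τ' ![(τ' : ℂ), 1] (hτ'im ▸ hy1)
  refine hG.trans (le_trans ?_ (hA₀ τ.im hyA))
  rw [hτ'im, hτ're, mul_assoc]
  refine mul_le_mul_of_nonneg_left (mul_le_mul_of_nonneg_right ?_ (Real.exp_pos _).le) hC0
  apply pow_le_pow_left₀ (by positivity)
  have hx'abs : |x'| ≤ N := by rw [abs_of_nonneg hx'.1]; exact hx'.2.le
  have hnorm : ‖(τ' : ℂ)‖ ≤ N + τ.im := by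
    refine (Complex.norm_le_abs_re_add_abs_im _).trans ?_
    rw [UpperHalfPlane.coe_re, UpperHalfPlane.coe_im, hτ're, hτ'im, abs_of_pos τ.im_pos]
    linarith
  simp only [Matrix.cons_val_one, Matrix.cons_val_zero, norm_one, mul_one]
  nlinarith [τ.im_pos]

/-- **The Eichler integral of a form with vanishing periods is a modular form of weight `-n`.** [cite: Shimura1971, Thm. 8.4 (injectivity of φ)] -/
def eichlerIntegralKForm (f : CuspForm (Gamma0 N) (n + 2))
    (hper : ∀ (γ : Gamma0 N) (p : Fin 2 → ℂ), periodFn n f γ p = 0) :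
    ModularForm (Gamma0 N) (-(n : ℤ)) where
  toFun := eichlerIntegralK n f
  slash_action_eq' := by
    rintro _ ⟨γ, hγ, rfl⟩
    exact eichlerIntegralK_slash_eq_self f ⟨γ, hγ⟩ (hper ⟨γ, hγ⟩)
  holo' := mdifferentiable_eichlerIntegralK f
  bdd_at_cusps' := by
    intro c hc
    rw [Subgroup.IsArithmetic.isCusp_iff_isCusp_SL2Z] at hc
    rw [OnePoint.isBoundedAt_iff_forall_SL2Z hc]
    intro g _
    exact isBoundedAtImInfty_eichlerIntegralK_slash f hper g

/-- A modular form of weight `k ≤ 0` on `Γ₀(N)` is constant (Mathlib: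
`ModularForm.isZero_of_neg_weight`, `ModularForm.eq_const_of_weight_zero`). [folklore] -/
theorem exists_eq_const_of_weight_nonpos {k : ℤ} (hk : k ≤ 0) (F : ModularForm (Gamma0 N) k) :
    ∃ c : ℂ, ∀ τ : ℍ, F τ = c := by
  rcases hk.lt_or_eq with hk | rfl
  · refine ⟨0, fun τ ↦ ?_⟩
    have h0 := ModularForm.isZero_of_neg_weight hk F
    rw [h0]
    rfl
  · obtain ⟨c, hc⟩ := ModularForm.eq_const_of_weight_zero F
    exact ⟨c, fun τ ↦ congr_fun hc τ⟩

/-- **Eichler–Shimura injectivity.** A cusp form `f ∈ S_{n+2}(Γ₀(N))` all of whose periods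
`c_f(γ)(u, v)`, `γ ∈ Γ₀(N)`, vanish is zero: its Eichler integral is a modular form of weight
`-n ≤ 0`, hence constant, and then `f = 0` by differentiating `n + 1` times. [cite: Shimura1971, Thm. 8.4 (injectivity of φ), p. 234] -/
theorem eq_zero_of_forall_periodFn_eq_zero (f : CuspForm (Gamma0 N) (n + 2))
    (hper : ∀ (γ : Gamma0 N) (p : Fin 2 → ℂ), periodFn n f γ p = 0) : f = 0 := by
  -- the Eichler integral is constant
  have hconst : ∃ c : ℂ, ∀ z : ℂ, 0 < z.im → eichlerKernel n ⇑f (ofComplex z) ![z, 1] = c := by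
    obtain ⟨c, hc⟩ := exists_eq_const_of_weight_nonpos (by omega) (eichlerIntegralKForm f hper)
    refine ⟨c, fun z hz ↦ ?_⟩
    have := hc (ofComplex z)
    change eichlerKernel n ⇑f (ofComplex z) ![((ofComplex z : ℍ) : ℂ), 1] = c at this
    rwa [coe_ofComplex hz] at this
  have hzero := (isCuspFunction_one f).eq_zero_of_eichlerKernel_diag_const n hconst
  exact DFunLike.ext f 0 fun τ ↦ by simpa using hzero τ

end Separation

/-! ### Integer points suffice -/

section IntegerPoints

variable {N : ℕ} [NeZero N] {n : ℕ}

omit [NeZero N] in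
/-- Along an affine line `t ↦ t a + b` the kernel is a polynomial in `t`. [folklore] -/
theorem exists_polynomial_eichlerKernel_affine (φ : ℍ → ℂ) (w : ℍ) (a b : Fin 2 → ℂ) :
    ∃ R : Polynomial ℂ, ∀ t : ℂ, eichlerKernel n φ w (t • a + b) = R.eval t := by
  refine ⟨∑ j ∈ Finset.range (n + 1), Polynomial.C ((n.choose j : ℂ) * powPrimitive j φ w) *
      (Polynomial.C (a 1) * Polynomial.X + Polynomial.C (b 1)) ^ j *
      (-(Polynomial.C (a 0) * Polynomial.X + Polynomial.C (b 0))) ^ (n - j), fun t ↦ ?_⟩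
  simp only [eichlerKernel, Polynomial.eval_finsetSum, Polynomial.eval_mul, Polynomial.eval_C,
    Polynomial.eval_pow, Polynomial.eval_neg, Polynomial.eval_X, Polynomial.eval_add,
    Pi.add_apply, Pi.smul_apply, smul_eq_mul]
  refine Finset.sum_congr rfl fun j _ ↦ ?_
  ring

omit [NeZero N] in
/-- Along an affine line the period function is a polynomial in `t`. [folklore] -/
theorem exists_polynomial_periodFn_affine (f : CuspForm (Gamma0 N) (n + 2)) (γ : SL(2, ℤ))
    (a b : Fin 2 → ℂ) :
    ∃ R : Polynomial ℂ, ∀ t : ℂ, periodFn n f γ (t • a + b) = R.eval t := by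
  obtain ⟨R₁, h₁⟩ := exists_polynomial_eichlerKernel_affine (n := n) (⇑f ∣[(n + 2 : ℤ)] γ)
    UpperHalfPlane.I a b
  obtain ⟨R₂, h₂⟩ := exists_polynomial_eichlerKernel_affine (n := n) ⇑f (γ • UpperHalfPlane.I)
    ((icmat γ).mulVec a) ((icmat γ).mulVec b)
  refine ⟨R₁ - R₂, fun t ↦ ?_⟩
  rw [periodFn, Matrix.mulVec_add, Matrix.mulVec_smul, h₁, h₂, Polynomial.eval_sub]

omit [NeZero N] in
/-- A polynomial vanishing at all integers is zero. [folklore] -/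
theorem Polynomial.eq_zero_of_forall_int_eval_eq_zero (R : Polynomial ℂ)
    (h : ∀ m : ℤ, R.eval (m : ℂ) = 0) : R = 0 :=
  Polynomial.eq_zero_of_infinite_isRoot R
    ((Set.infinite_range_of_injective Int.cast_injective).mono (by
      rintro _ ⟨m, rfl⟩
      exact h m))

omit [NeZero N] in
/-- **If the periods of `γ` vanish at all integer points `(u, v) ∈ ℤ²` they vanish identically**
(they are polynomial in `(u, v)`). [folklore] -/
theorem periodFn_eq_zero_of_forall_int (f : CuspForm (Gamma0 N) (n + 2)) (γ : SL(2, ℤ))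
    (h : ∀ q : Fin 2 → ℤ, periodFn n f γ (fun i ↦ (q i : ℂ)) = 0) (p : Fin 2 → ℂ) :
    periodFn n f γ p = 0 := by
  -- step 1: `v ∈ ℤ`, `u ∈ ℂ`
  have h1 : ∀ (v : ℤ) (u : ℂ), periodFn n f γ ![u, (v : ℂ)] = 0 := by
    intro v u
    obtain ⟨R, hR⟩ := exists_polynomial_periodFn_affine f γ ![1, 0] ![0, (v : ℂ)]
    have hline : ∀ t : ℂ, t • ![(1 : ℂ), 0] + ![0, (v : ℂ)] = ![t, (v : ℂ)] := fun t ↦ by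
      funext i; fin_cases i <;> simp
    have hR0 : R = 0 := by
      refine Polynomial.eq_zero_of_forall_int_eval_eq_zero R fun m ↦ ?_
      rw [← hR, hline]
      have := h ![m, v]
      convert this using 2
      funext i; fin_cases i <;> simp
    have := hR u
    rwa [hline, hR0, Polynomial.eval_zero] at this
  -- step 2: `u ∈ ℂ`, `v ∈ ℂ`
  have h2 : ∀ u v : ℂ, periodFn n f γ ![u, v] = 0 := by
    intro u v
    obtain ⟨R, hR⟩ := exists_polynomial_periodFn_affine f γ ![0, 1] ![u, 0]
    have hline : ∀ t : ℂ, t • ![(0 : ℂ), 1] + ![u, 0] = ![u, t] := fun t ↦ by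
      funext i; fin_cases i <;> simp
    have hR0 : R = 0 := by
      refine Polynomial.eq_zero_of_forall_int_eval_eq_zero R fun m ↦ ?_
      rw [← hR, hline]
      exact h1 m u
    have := hR v
    rwa [hline, hR0, Polynomial.eval_zero] at this
  have hp : p = ![p 0, p 1] := by funext i; fin_cases i <;> simp
  rw [hp]
  exact h2 _ _

/-- **Separation by the period lattice.** If every period functional `λ_{γ,q}`, `γ ∈ Γ₀(N)`,
`q ∈ ℤ²`, vanishes on `f ∈ S_{n+2}(Γ₀(N))`, then `f = 0`. [cite: Shimura1971, Thm. 8.4] -/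
theorem eq_zero_of_forall_periodFunctionalK_eq_zero (f : CuspForm (Gamma0 N) (n + 2))
    (h : ∀ (γ : Gamma0 N) (q : Fin 2 → ℤ), periodFunctionalK n γ q f = 0) : f = 0 :=
  eq_zero_of_forall_periodFn_eq_zero f fun γ p ↦
    periodFn_eq_zero_of_forall_int f γ (fun q ↦ h γ q) p

/-- Equivalently: if `φ(f) = 0` for all `φ` in the period lattice then `f = 0`. [folklore] -/
theorem eq_zero_of_forall_mem_periodLatticeK (f : CuspForm (Gamma0 N) (n + 2))
    (h : ∀ φ ∈ periodLatticeK (N := N) n, φ f = 0) : f = 0 :=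
  eq_zero_of_forall_periodFunctionalK_eq_zero f fun γ q ↦ h _ (periodFunctionalK_mem γ q)

end IntegerPoints

/-! ### Hecke operators preserve the period lattice -/

section HeckeMatrices

variable {N : ℕ} {p : ℕ}

/-- The complexification of an integer matrix. [folklore] -/
def zcmat (M : Matrix (Fin 2) (Fin 2) ℤ) : Matrix (Fin 2) (Fin 2) ℂ := M.map (↑)

/-- Entries of the complexified matrix. [folklore] -/
@[simp] theorem zcmat_apply (M : Matrix (Fin 2) (Fin 2) ℤ) (i j : Fin 2) :
    zcmat M i j = ((M i j : ℤ) : ℂ) := rfl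

/-- `icmat` is `zcmat` of the underlying matrix. [folklore] -/
theorem icmat_eq_zcmat (γ : SL(2, ℤ)) : icmat γ = zcmat γ := rfl

/-- Complexification is multiplicative. [folklore] -/
theorem zcmat_mul (M M' : Matrix (Fin 2) (Fin 2) ℤ) : zcmat (M * M') = zcmat M * zcmat M' := by
  simp only [zcmat]
  exact Matrix.map_mul (f := Int.castRingHom ℂ)

/-- The complexification of `intGL M` is that of `M`. [folklore] -/
theorem cmat_intGL {M : Matrix (Fin 2) (Fin 2) ℤ} (hM : M.det ≠ 0) : cmat (intGL M) = zcmat M := by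
  ext i j
  simp [cmat, intGL_apply hM]

/-- Integer matrices act on integer vectors. [folklore] -/
theorem zcmat_mulVec_intCast (M : Matrix (Fin 2) (Fin 2) ℤ) (q : Fin 2 → ℤ) :
    (zcmat M).mulVec (fun i ↦ (q i : ℂ)) = fun i ↦ ((M.mulVec q) i : ℂ) := by
  funext i
  simp [Matrix.mulVec, dotProduct, Fin.sum_univ_two]

/-- `det (intGL M) = det M`. [folklore] -/
theorem det_intGL_val {M : Matrix (Fin 2) (Fin 2) ℤ} (hM : M.det ≠ 0) :
    (intGL M).det.val = (M.det : ℝ) := by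
  rw [Matrix.GeneralLinearGroup.val_det_apply, coe_intGL hM, ← RingHom.mapMatrix_apply,
    ← RingHom.map_det, eq_intCast]

/-- **Periodicity of translates by upper-triangular matrices**: if `f ∘ ofComplex` has period `1`
and `g = (a b; 0 d)`, `det g > 0`, `a T = m d` with `m ∈ ℤ`, then `(f ∣[k] g) ∘ ofComplex` has
period `T` (indeed `g(w + T) = g(w) + m`). [folklore] -/
theorem periodic_slash_of_upper {f : ℍ → ℂ} (hf : Periodic (f ∘ ofComplex) 1) (k : ℤ)
    {g : GL (Fin 2) ℝ} (hg : 0 < g.det.val) (hg10 : g 1 0 = 0) {T : ℝ} {m : ℤ}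
    (hT : g 0 0 * T = m * g 1 1) : Periodic ((f ∣[k] g) ∘ ofComplex) T := by
  have hdet : g.det.val = g 0 0 * g 1 1 := by
    rw [Matrix.GeneralLinearGroup.val_det_apply, Matrix.det_fin_two, hg10]; ring
  have hd : (g 1 1 : ℝ) ≠ 0 := fun h0 ↦ by rw [hdet, h0, mul_zero] at hg; exact lt_irrefl _ hg
  intro w
  by_cases hw : 0 < w.im
  · have hw' : 0 < (w + T).im := by simpa using hw
    simp only [comp_apply, ModularForm.slash_apply, σ_eq_self hg]
    have hden : ∀ z : ℂ, denom g z = (g 1 1 : ℝ) := fun z ↦ by simp [denom, hg10]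
    have hden' : ∀ τ : ℍ, denom g τ = (g 1 1 : ℝ) := fun τ ↦ hden τ
    rw [hden', hden']
    congr 2
    rw [smul_ofComplex_of_det_pos hg hw, smul_ofComplex_of_det_pos hg hw', hden, hden]
    have hd' : ((g 1 1 : ℝ) : ℂ) ≠ 0 := by exact_mod_cast hd
    have key : num g (w + T) / (g 1 1 : ℝ) = num g w / (g 1 1 : ℝ) + (m : ℂ) * 1 := by
      have hT' : ((g 0 0 : ℝ) : ℂ) * T = m * (g 1 1 : ℝ) := by exact_mod_cast hT
      have hnum : num g (w + T) = num g w + m * (g 1 1 : ℝ) := by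
        simp only [num]
        linear_combination hT'
      rw [hnum, add_div, mul_div_cancel_right₀ _ hd', mul_one]
    rw [key]
    exact hf.int_mul m _
  · have hw' : (w + T).im ≤ 0 := by simpa using hw
    simp only [comp_apply, ofComplex_apply_eq_of_im_nonpos hw' (not_lt.mp hw)]

variable [NeZero p]

/-- `(intGL βᵢ) 1 0 = 0`. [folklore] -/
theorem intGL_heckeRep_apply_one_zero (i : Option (ZMod p)) : (intGL (heckeRep p i)) 1 0 = 0 := by
  rw [intGL_apply (det_heckeRep_ne_zero (NeZero.ne p) i)]
  cases i <;> simp [heckeRep]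

/-- `det (intGL βᵢ) = p > 0`. [folklore] -/
theorem det_intGL_heckeRep_pos (i : Option (ZMod p)) : 0 < (intGL (heckeRep p i)).det.val := by
  rw [det_intGL_val (det_heckeRep_ne_zero (NeZero.ne p) i), det_heckeRep]
  exact_mod_cast NeZero.pos p

omit [NeZero p] in
/-- The matrix of `γ ∈ Γ₀(N)` lies in `Δ₀ᴺ(1)`. [folklore] -/
theorem coe_mem_delta0_one (γ : Gamma0 N) :
    ((γ : SL(2, ℤ)) : Matrix (Fin 2) (Fin 2) ℤ) ∈ Delta0 N 1 := by
  obtain ⟨M, hM, hMeq⟩ := (exists_mem_delta0_one_iff (N := N)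
    (fun M ↦ M = ((γ : SL(2, ℤ)) : Matrix (Fin 2) (Fin 2) ℤ))).mpr ⟨γ, γ.2, rfl⟩
  exact hMeq ▸ hM

omit [NeZero p] in
/-- `1 ∈ Δ₀ᴺ(1)`. [folklore] -/
theorem one_mem_delta0_one : (1 : Matrix (Fin 2) (Fin 2) ℤ) ∈ Delta0 N 1 :=
  ⟨Matrix.det_one, by simp, by simp [isCoprime_one_left]⟩

variable (hp : p.Prime)
include hp

omit [NeZero p] in
/-- A prime does not divide `1`. [folklore] -/
theorem not_intCast_dvd_one : ¬((p : ℤ) ∣ 1) := fun h ↦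
  hp.one_lt.ne' (by exact_mod_cast Int.eq_one_of_dvd_one (Int.natCast_nonneg p) h)

omit [NeZero p] in
/-- **The right action of `Γ₀(N)` on the Hecke cosets**: `βᵢ γ = γ' β_{i'}` for a unique `i'`. [cite: Shimura1971, §8.3 p. 237 (αᵢγ = γᵢαⱼ)] -/
theorem existsUnique_heckeRep_mul_coe (γ : Gamma0 N) (i : HeckeIdx N p) :
    ∃! i' : HeckeIdx N p, ∃ M' ∈ Delta0 N 1,
      M' * heckeRep p i'.1 = heckeRep p i.1 * ((γ : SL(2, ℤ)) : Matrix (Fin 2) (Fin 2) ℤ) := by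
  have hM : heckeRep p i.1 * ((γ : SL(2, ℤ)) : Matrix (Fin 2) (Fin 2) ℤ) ∈ Delta0 N (p * 1) := by
    exact mul_mem_delta0 (heckeRep_mem_delta0 hp i) (coe_mem_delta0_one γ)
  exact existsUnique_mem_delta0_mul_heckeRep hp (D := 1) (not_intCast_dvd_one hp) hM

omit [NeZero p] in
/-- The permutation `i ↦ i'` of the Hecke cosets induced by `γ ∈ Γ₀(N)`. [cite: Shimura1971, §8.3 p. 237] -/
def heckePerm (γ : Gamma0 N) (i : HeckeIdx N p) : HeckeIdx N p :=
  (existsUnique_heckeRep_mul_coe hp γ i).exists.choose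

omit [NeZero p] in
/-- The defining property of `heckePerm`: `βᵢ γ ∈ Γ₀(N) β_{σ(i)}`. [folklore] -/
theorem heckePerm_spec (γ : Gamma0 N) (i : HeckeIdx N p) :
    ∃ γ' : Gamma0 N,
      ((γ' : SL(2, ℤ)) : Matrix (Fin 2) (Fin 2) ℤ) * heckeRep p (heckePerm hp γ i).1 =
      heckeRep p i.1 * ((γ : SL(2, ℤ)) : Matrix (Fin 2) (Fin 2) ℤ) := by
  obtain ⟨M', hM', hM'eq⟩ := (existsUnique_heckeRep_mul_coe hp γ i).exists.choose_spec
  obtain ⟨γ', hγ', h⟩ := (exists_mem_delta0_one_iff (N := N)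
    (fun M ↦ M * heckeRep p (heckePerm hp γ i).1 =
      heckeRep p i.1 * ((γ : SL(2, ℤ)) : Matrix (Fin 2) (Fin 2) ℤ))).mp ⟨M', hM', hM'eq⟩
  exact ⟨⟨γ', hγ'⟩, h⟩

omit [NeZero p] in
/-- The element `γ' ∈ Γ₀(N)` with `βᵢ γ = γ' β_{σ(i)}`. [folklore] -/
def heckePermElt (γ : Gamma0 N) (i : HeckeIdx N p) : Gamma0 N :=
  (heckePerm_spec hp γ i).choose

omit [NeZero p] in
/-- The defining property `γ'ᵢ β_{σ(i)} = βᵢ γ`. [folklore] -/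
theorem heckePermElt_spec (γ : Gamma0 N) (i : HeckeIdx N p) :
    ((heckePermElt hp γ i : SL(2, ℤ)) : Matrix (Fin 2) (Fin 2) ℤ) *
        heckeRep p (heckePerm hp γ i).1 =
      heckeRep p i.1 * ((γ : SL(2, ℤ)) : Matrix (Fin 2) (Fin 2) ℤ) :=
  (heckePerm_spec hp γ i).choose_spec

omit [NeZero p] in
/-- The permutation of the Hecke cosets is injective, hence bijective. [folklore] -/
theorem heckePerm_injective (γ : Gamma0 N) : Function.Injective (heckePerm (N := N) hp γ) := by
  intro i₁ i₂ h
  set δ : Gamma0 N := heckePermElt hp γ i₂ * (heckePermElt hp γ i₁)⁻¹ with hδ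
  have h₁ := heckePermElt_spec hp γ i₁
  have h₂ := heckePermElt_spec hp γ i₂
  rw [← h] at h₂
  -- `β_{i₂} γ = δ β_{i₁} γ`
  set A₁ : Matrix (Fin 2) (Fin 2) ℤ :=
    ((heckePermElt hp γ i₁ : SL(2, ℤ)) : Matrix (Fin 2) (Fin 2) ℤ)
  set A₂ : Matrix (Fin 2) (Fin 2) ℤ :=
    ((heckePermElt hp γ i₂ : SL(2, ℤ)) : Matrix (Fin 2) (Fin 2) ℤ)
  set A₁' : Matrix (Fin 2) (Fin 2) ℤ :=
    ((((heckePermElt hp γ i₁)⁻¹ : Gamma0 N) : SL(2, ℤ)) : Matrix (Fin 2) (Fin 2) ℤ)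
  set G : Matrix (Fin 2) (Fin 2) ℤ := ((γ : SL(2, ℤ)) : Matrix (Fin 2) (Fin 2) ℤ)
  have hinv : (((heckePermElt hp γ i₁)⁻¹ : Gamma0 N) : SL(2, ℤ)) *
      (heckePermElt hp γ i₁ : SL(2, ℤ)) = 1 := by simp
  have hinv' : A₁' * A₁ = 1 := by
    simp only [A₁', A₁]
    rw [← Matrix.SpecialLinearGroup.coe_mul, hinv, Matrix.SpecialLinearGroup.coe_one]
  have hδ' : ((δ : SL(2, ℤ)) : Matrix (Fin 2) (Fin 2) ℤ) = A₂ * A₁' := by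
    simp only [hδ, A₂, A₁', Subgroup.coe_mul, Matrix.SpecialLinearGroup.coe_mul]
  have key : heckeRep p i₂.1 * G = (A₂ * A₁' * heckeRep p i₁.1) * G := by
    calc heckeRep p i₂.1 * G = A₂ * heckeRep p (heckePerm hp γ i₁).1 := h₂.symm
      _ = A₂ * (A₁' * A₁) * heckeRep p (heckePerm hp γ i₁).1 := by rw [hinv', Matrix.mul_one]
      _ = A₂ * A₁' * (A₁ * heckeRep p (heckePerm hp γ i₁).1) := by
          simp only [Matrix.mul_assoc]
      _ = A₂ * A₁' * (heckeRep p i₁.1 * G) := by rw [h₁]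
      _ = (A₂ * A₁' * heckeRep p i₁.1) * G := by simp only [Matrix.mul_assoc]
  have hGdet : G.det ≠ 0 := by
    simp only [G, Matrix.SpecialLinearGroup.det_coe]; exact one_ne_zero
  have key' : heckeRep p i₂.1 = ((δ : SL(2, ℤ)) : Matrix (Fin 2) (Fin 2) ℤ) * heckeRep p i₁.1 := by
    rw [hδ']
    exact matrix_mul_right_cancel_of_det_ne_zero hGdet key
  -- uniqueness of the coset index of `β_{i₂}`
  have hM : heckeRep p i₂.1 ∈ Delta0 N (p * 1) := by simpa using heckeRep_mem_delta0 hp i₂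
  have hu := existsUnique_mem_delta0_mul_heckeRep hp (D := 1) (not_intCast_dvd_one hp) hM
  exact (hu.unique ⟨1, one_mem_delta0_one, by rw [Matrix.one_mul]⟩
    ⟨_, coe_mem_delta0_one δ, key'.symm⟩).symm

/-- The permutation of the Hecke cosets as an equivalence. [folklore] -/
def heckePermEquiv (γ : Gamma0 N) : HeckeIdx N p ≃ HeckeIdx N p :=
  haveI : Fact p.Prime := ⟨hp⟩
  Equiv.ofBijective _ (Finite.injective_iff_bijective.mp (heckePerm_injective hp γ))

/-- Unfolding `heckePermEquiv`. [folklore] -/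
@[simp] theorem heckePermEquiv_apply (γ : Gamma0 N) (i : HeckeIdx N p) :
    heckePermEquiv hp γ i = heckePerm hp γ i := rfl

/-- In `GL(2, ℝ)`: `βᵢ γ = γ' β_{σ(i)}`. [folklore] -/
theorem intGL_heckeRep_mul (γ : Gamma0 N) (i : HeckeIdx N p) :
    intGL (heckeRep p i.1) * ((γ : SL(2, ℤ)) : GL (Fin 2) ℝ) =
      ((heckePermElt hp γ i : SL(2, ℤ)) : GL (Fin 2) ℝ) *
        intGL (heckeRep p (heckePerm hp γ i).1) := by
  have hp0 := det_heckeRep_ne_zero (NeZero.ne p)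
  have h1 : ((γ : SL(2, ℤ)) : GL (Fin 2) ℝ) = intGL (γ : SL(2, ℤ)) := mapGL_eq_intGL _
  have h2 : ((heckePermElt hp γ i : SL(2, ℤ)) : GL (Fin 2) ℝ) =
      intGL (heckePermElt hp γ i : SL(2, ℤ)) :=
    mapGL_eq_intGL _
  rw [h1, h2, ← intGL_mul (hp0 _) (by simp), ← intGL_mul (by simp) (hp0 _), heckePermElt_spec]

end HeckeMatrices

section HeckePeriods

variable {N : ℕ} [NeZero N] {n : ℕ} {p : ℕ} [NeZero p]

/-- **The translates `f ∣ βᵢ` are cusp functions of period `p`.** [cite: DiamondShurman2005, Prop. 5.2.1] -/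
theorem isCuspFunction_slash_heckeRep (f : CuspForm (Gamma0 N) (n + 2)) (i : Option (ZMod p)) :
    IsCuspFunction p (⇑f ∣[(n + 2 : ℤ)] intGL (heckeRep p i)) where
  pos := by exact_mod_cast NeZero.pos p
  periodic := by
    have hp0 := det_heckeRep_ne_zero (NeZero.ne p) i
    cases i with
    | none =>
      refine periodic_slash_of_upper (isCuspFunction_one f).periodic _ (det_intGL_heckeRep_pos _)
        (intGL_heckeRep_apply_one_zero _) (m := (p : ℤ) * p) ?_
      rw [intGL_apply hp0, intGL_apply hp0]
      simp [heckeRep]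
    | some j =>
      refine periodic_slash_of_upper (isCuspFunction_one f).periodic _ (det_intGL_heckeRep_pos _)
        (intGL_heckeRep_apply_one_zero _) (m := 1) ?_
      rw [intGL_apply hp0, intGL_apply hp0]
      simp [heckeRep]
  mdifferentiable := (ModularFormClass.holo f).slash _ _
  isZeroAtImInfty := (CuspFormClass.zero_at_infty f).slash _ (intGL_heckeRep_apply_one_zero i)

variable (hp : p.Prime)
include hp

/-- **Hecke operators on the period cocycle**:
`c_{T_p f}(γ)(q) = ∑ᵢ c_f(γ'ᵢ)(β_{σ(i)} q)` for `γ ∈ Γ₀(N)`. [cite: Shimura1971, §8.3 (8.3.2) and Prop. 8.5] -/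
theorem periodFn_heckeT (f : CuspForm (Gamma0 N) (n + 2)) (γ : Gamma0 N) (q : Fin 2 → ℂ) :
    periodFn n (heckeT (Gamma0 N) (n + 2) p f) γ q =
      ∑ i : HeckeIdx N p, periodFn n f (heckePermElt hp γ i)
        ((zcmat (heckeRep p (heckePerm hp γ i).1)).mulVec q) := by
  haveI : Fact p.Prime := ⟨hp⟩
  have hp0 := det_heckeRep_ne_zero (NeZero.ne p)
  set τ : ℍ := UpperHalfPlane.I
  have hT := coe_heckeT_gamma0 (N := N) (k := (n + 2 : ℤ)) p hp f
  -- `E(T_p f) = ∑ᵢ E(f ∣ βᵢ) = ∑ᵢ E(f)(βᵢ·)(βᵢ·)`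
  have hE : ∀ (w : ℍ) (q' : Fin 2 → ℂ), eichlerKernel n ⇑(heckeT (Gamma0 N) (n + 2) p f) w q' =
      ∑ i : HeckeIdx N p, eichlerKernel n ⇑f (intGL (heckeRep p i.1) • w)
        ((zcmat (heckeRep p i.1)).mulVec q') := by
    intro w q'
    rw [hT, eichlerKernel_finset_sum Finset.univ (fun i _ ↦ isCuspFunction_slash_heckeRep f i.1)]
    refine Finset.sum_congr rfl fun i _ ↦ ?_
    rw [(isCuspFunction_one f).eichlerKernel_slash_eq_of_apply_one_zero (det_intGL_heckeRep_pos _)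
      (intGL_heckeRep_apply_one_zero _) (isCuspFunction_slash_heckeRep f i.1), cmat_intGL (hp0 _)]
  rw [periodFn_eq_of_mem _ γ q τ, hE, hE]
  -- rewrite the second sum through the permutation
  have h2 : ∀ i : HeckeIdx N p,
      eichlerKernel n ⇑f (intGL (heckeRep p i.1) • (γ : SL(2, ℤ)) • τ)
        ((zcmat (heckeRep p i.1)).mulVec ((icmat γ).mulVec q)) =
      eichlerKernel n ⇑f (intGL (heckeRep p (heckePerm hp γ i).1) • τ)
          ((zcmat (heckeRep p (heckePerm hp γ i).1)).mulVec q) -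
        periodFn n f (heckePermElt hp γ i)
          ((zcmat (heckeRep p (heckePerm hp γ i).1)).mulVec q) := by
    intro i
    rw [periodFn_eq_of_mem f _ _ (intGL (heckeRep p (heckePerm hp γ i).1) • τ), sub_sub_cancel,
      ModularGroup.sl_moeb, ModularGroup.sl_moeb, ← mul_smul, ← mul_smul, intGL_heckeRep_mul,
      Matrix.mulVec_mulVec, Matrix.mulVec_mulVec, icmat_eq_zcmat, icmat_eq_zcmat, ← zcmat_mul,
      ← zcmat_mul, ← heckePermElt_spec hp γ i]
  simp_rw [h2]
  rw [Finset.sum_sub_distrib]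
  have hre : (∑ x : HeckeIdx N p, eichlerKernel n ⇑f (intGL (heckeRep p (heckePerm hp γ x).1) • τ)
      ((zcmat (heckeRep p (heckePerm hp γ x).1)).mulVec q)) =
      ∑ i : HeckeIdx N p, eichlerKernel n ⇑f (intGL (heckeRep p i.1) • τ)
        ((zcmat (heckeRep p i.1)).mulVec q) :=
    Equiv.sum_comp (heckePermEquiv hp γ) (fun i : HeckeIdx N p ↦
      eichlerKernel n ⇑f (intGL (heckeRep p i.1) • τ) ((zcmat (heckeRep p i.1)).mulVec q))
  rw [hre]
  ring

/-- **Hecke operators on the period functionals**: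
`T_p^∨ λ_{γ,q} = ∑ᵢ λ_{γ'ᵢ, β_{σ(i)} q}` — an integral combination of period functionals. [cite: Shimura1971, §8.3 (8.3.2) and Prop. 8.5] -/
theorem dualMap_heckeT_periodFunctionalK (γ : Gamma0 N) (q : Fin 2 → ℤ) :
    (heckeT (Gamma0 N) (n + 2) p).dualMap (periodFunctionalK n γ q) =
      ∑ i : HeckeIdx N p, periodFunctionalK n (heckePermElt hp γ i)
        ((heckeRep p (heckePerm hp γ i).1).mulVec q) := by
  haveI : Fact p.Prime := ⟨hp⟩
  ext f
  simp only [LinearMap.dualMap_apply, periodFunctionalK_apply, LinearMap.coe_sum,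
    Finset.sum_apply]
  rw [periodFn_heckeT hp]
  refine Finset.sum_congr rfl fun i _ ↦ ?_
  rw [zcmat_mulVec_intCast]

/-- **The Hecke operators `T_p^∨` preserve the Eichler–Shimura period lattice.** [cite: Shimura1971, §8.4 p. 240 (ΓαΓ is stable on H¹_P(Γ, D))] -/
theorem dualMap_heckeT_mem_periodLatticeK {φ : Module.Dual ℂ (CuspForm (Gamma0 N) (n + 2))}
    (hφ : φ ∈ periodLatticeK (N := N) n) :
    (heckeT (Gamma0 N) (n + 2) p).dualMap φ ∈ periodLatticeK (N := N) n := by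
  haveI : Fact p.Prime := ⟨hp⟩
  induction hφ using AddSubgroup.closure_induction with
  | mem x hx =>
    obtain ⟨⟨γ, q⟩, rfl⟩ := hx
    rw [dualMap_heckeT_periodFunctionalK hp]
    exact AddSubgroup.sum_mem _ fun i _ ↦ periodFunctionalK_mem _ _
  | zero => simp [zero_mem]
  | add x y _ _ hx hy => rw [map_add]; exact add_mem hx hy
  | neg x _ hx => rw [map_neg]; exact neg_mem hx

end HeckePeriods

/-! ### Summary: the period lattice is a finitely generated, Hecke-stable, separating subgroup -/

section Summary

variable (N : ℕ) [NeZero N] (n : ℕ)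

/-- **The Eichler–Shimura period lattice of `S_{n+2}(Γ₀(N))`** is a finitely generated subgroup of
the dual space, stable under the transposes `T_p^∨` of all Hecke operators `T_p` (`p` prime) and
separating the points of `S_{n+2}(Γ₀(N))`. This is the structure behind Shimura 1971, (3.5.20)
(proved there in §8.4 from Thm. 8.4, Prop. 8.5, Prop. 8.6). [cite: Shimura1971, (3.5.20) p. 84 and §8.4 pp. 239–241] -/
theorem periodLatticeK_fg_heckeStable_separating :
    (periodLatticeK (N := N) n).FG ∧
    (∀ (p : ℕ) (hp : p.Prime), ∀ φ ∈ periodLatticeK (N := N) n,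
      (haveI : NeZero p := ⟨hp.ne_zero⟩; (heckeT (Gamma0 N) (n + 2) p).dualMap φ) ∈
        periodLatticeK (N := N) n) ∧
    ∀ f : CuspForm (Gamma0 N) (n + 2), (∀ φ ∈ periodLatticeK (N := N) n, φ f = 0) → f = 0 := by
  refine ⟨periodLatticeK_fg N n, fun p hp φ hφ ↦ ?_,
    fun f hf ↦ eq_zero_of_forall_mem_periodLatticeK f hf⟩
  haveI : NeZero p := ⟨hp.ne_zero⟩
  exact dualMap_heckeT_mem_periodLatticeK hp hφ

end Summary

end Literature.NumberTheory.EllipticCurves.ModularForms
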